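import Literature.MathematicalPhysics.QuantumFieldTheory.Balaban1983to89.B1Eq324BenfattoClassSectEMemberCoReadProduct
import Literature.MathematicalPhysics.QuantumFieldTheory.Balaban1983to89.Node00.OpsYSectEElimSmall
import Literature.MathematicalPhysics.QuantumFieldTheory.Balaban1983to89.Node00.OpsYSectDReal
import Literature.MathematicalPhysics.QuantumFieldTheory.Balaban1983to89.Node00.OpsYD2JForm
import Literature.MathematicalPhysics.QuantumFieldTheory.Balaban1983to89.Node00.OpsYSectEElimAxial
import Literature.MathematicalPhysics.QuantumFieldTheory.Balaban1983to89.B1Eq324BenfattoClassSectEMemberERowsAtNode00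

/-!
# `Balaban1983to89.B1Eq324BenfattoClassSectEMemberRealAdjointAtNode00` — THE LETTERS `C(V)`, `C(V)*` OF [Balaban1985BackgroundPropagators] (3.157) ARE REAL
# OPERATORS, HENCE AN ADJOINT PAIR FOR THE HERMITIAN TRACE PAIRING; THE β-ADJOINTNESS ROWS (R1′)(R3′) OF THE (3.24) PRECISION DOOR FOR `dμ_{C̃^{(k)}(Λ; U)}`
# DISCHARGED AT NODE 00's GENUINE SEVEN-LETTER RECORD, FIBRE `M_N(ℂ)` (seat dag-n08-b gen 33, CLAIM-8; node N08 [Balaban1985UV3], row `h324c`)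

statement-level companion of published sources with citation tags; every declaration here is a theorem; nothing here is a claim about the
Yang–Mills mass gap

THE PRINTED LOCUS.  [Balaban1985BackgroundPropagators] (= [B9]) Sect. E p. 428: *"An arbitrary function B on this subspace can be represented with the help
of a function B̃ defined on Λ̃ … we define the linear operator C by B = CB̃ (3.157). It is an identity operator on almost all bonds, except the bonds b₀ where
(CB)(b₀) is equal to a solution of the equation (QB)(c) = 0 … e^{½⟨C*g,(C*Δ_kC)⁻¹C*g⟩} … C^{(k)}(Λ) = C C̃^{(k)}(Λ) C* (3.158)"*; p. 391: the operators of the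
paper act on *"functions with values in N × N hermitian matrices"* (the lineage's «`𝔤`-valued» functions), p. 390: `G ⊂ U(N)`, `R(U)X = UXU⁻¹`; (3.9) p. 391 and
p. 393: adjoints for the trace scalar products `X·Y = tr XY` summed over the lattice.  [Balaban1985Averaging] (125) p. 36: the one-step averaging `Q(V)` of a bond
function, transports (56)–(58) p. 27.  [Balaban1985UV3] (= [B10]) (24) p. 262 cites [Balaban1982Higgs1] (3.24) for the cumulant remainder of the Gaussian
integration determined by *"the positive quadratic form ⟨A, C*Δ_kCA⟩"* (pp. 271–272) — node N08's row `h324c`.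

WHY THIS MODULE (cell `pub-ymgap`, seat `dag-n08-b` gen 33, CLAIM-8; seat n08-c g65's door-row map «(R3′) record-instance adjointness … in -b's lane»; this
seat's HANDOFF §gen 31∕32 «the β-vs-τ adjointness junction»).  The seat's precision door p669260 `…CoReadProduct.eq324_CsDeltaCY_precision_node00_on_unit`
delivers [Balaban1982Higgs1] (3.24) for `𝒩(0, 𝕄_Λ̃(C*Δ_kC)⁻¹)` at NODE 00's named letters GIVEN five displayed rows; two of them are β-ADJOINTNESS rows for a
real symmetric pairing `β` on the fibre: (R1′) `(QG₁Q*)⁻¹(U)` and `a + ⟨D̃⁽²⁾·,J⟩(U)` β-self-adjoint over the carrier, (R3′) `P_Λ C P_Λ̃` and `P_Λ̃ C* P_Λ`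
β-adjoint over the carrier.  The cell's letters of record live on the fibre `M_N(ℂ)` with the Hermitian trace pairing `β = Re tr(vᴴw)` (seat n06-d's
`trReForm`, seat n06-j's `trIP 1` ∕ `IsSymmTr 1` ∕ `IsAdjTr 1 1`), whereas NODE 00 (def-Y, `Node00.OpsYSectEElim`) proved the transposition of its genuine
`C(V) = elimCY`, `C(V)* = elimCtY` for the FLAT (bilinear) trace pairing `Σ_q tr(B(q)A(q))` (`sum_tr_elimCY_mul`).  The two pairings agree on adjoints exactly
for REAL operators — those commuting with the pointwise conjugate transpose (def-Y's `OpsYSectDReal.IsRealOpY`, proved there for every Sect. A–D letter but not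
for `C ∕ C*`).  THIS FILE proves `C(V)`, `C(V)*` real at a unitary-valued averaged field, turns def-Y's flat transposition into the door's (R3′), reads (R1′) off
seat n06-j's `IsSymmTr 1`, computes the frame constants of the real trace basis under the `L²`-operator norm, and fires the door at the record fibre with
(R1′) in `IsSymmTr` currency and (R3′) replaced by «`V(b) ∈ U(N)`, pivot coefficients units» (automatic at `U = 1` and in def-Y's small-field regime).

WHAT IS PROVED (standard axioms; no `sorry`; no definition).
* §0 (generic complete normed `ℂ`-algebra with a `StarRing`): `star_hol_apply` ∕ `star_hol_symm_apply` ∕ `star_trSum` ∕ `star_trSumT` (`star` through the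
  (3.169) transports along chains when it passes every bond transport) · ★ `star_ringInverse_apply` (the total `Ring.inverse` of a real endomorphism OF THE
  FIBRE is real — the fibre twin of def-Y's `IsRealOpY.ringInverse`).
* §1 (fibre `M_N(ℂ)`): ★★ `sum_trReForm_adjoint_of_trace_transpose_of_real` — a flat-trace adjoint pair `(C, C†)` with `C†` real IS a `trReForm`-adjoint pair in
  the door's (R3′) shape (the adjoint-pair twin of def-Y's `OpsYDelta2Form.isSymmTr_of_trSymm_of_real`) · ★ `isAdjTr_of_trace_transpose_of_real` (the same as
  seat n06-j's `IsAdjTr 1 1 C C†`).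
* §2 REALITY (generic fibre with `StarModule ℂ`, member `x`, averaged-field parameter `𝔳`, star-unitary `V = 𝔳 U`: `V(b)⁻¹ = V(b)⋆`): `star_readUY`,
  `star_placeUY`, `star_secY_apply` ∕ `secY_isRealOpY`, `star_qNormY`, `star_RUY` ∕ `star_RUTY` ∕ `star_RVY` (pv27 `star_R`), `star_q1FunY`, ★ `star_Q1Y`
  (`Q(V)` of (125) is real), ★ `star_KY`, ★★ `elimCY_isRealOpY` (`C(V)` IS REAL), `star_q1TFunY`, ★ `star_Q1TY`, ★ `star_KTY`, ★★ `elimCtY_isRealOpY` (`C(V)*` IS REAL).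
* §3 (fibre `M_N(ℂ)`): `elimCY_isRealOpY_of_unitary` ∕ `elimCtY_…` (`V(b) ∈ U(N)`) · `elimCY_avYOfRecord_isRealOpY` ∕ `elimCtY_…` (`G ≤ U(N)`, `G`-valued `U`) ·
  ★★ `isAdjTr_elimCY_elimCtY` · ★★★ `sum_trReForm_elimCΛY_ofRecordTC` — (R3′) of p669260 AT `𝔢 := sectELettersYOfRecordTC x 𝔳 𝔢₀` given `V(b) ∈ U(N)` and the
  pivot units `hK ∕ hKT` · ★★ `…_of_smallVY` (no `IsUnit` binder: def-Y `SmallVY`, `G ≤ U(N)`) · ★★ `…_one` (`U = 1`, HYPOTHESIS-FREE) · ★★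
  `sum_trReForm_elimCΛY_sectEYOfRecordV6` ∕ `…_of_smallVY` (at the v6 instance of record).
* §4 (R1′): `isSymmTr_aY` (the weight letter `a` is `IsSymmTr 1`: n06-j `isSymmTr_liftOpY` + `aK_isSymm`) · `isSymmTr_aY_add_D2J` · ★ `selfAdjoint_QG1Qinv_of_isSymmTr` ·
  ★ `selfAdjoint_aY_add_D2J_of_isSymmTr` (the door's (R1′) shapes from `IsSymmTr 1 ((QG₁Q*)⁻¹(U))`, `IsSymmTr 1 (⟨D̃⁽²⁾·,J⟩(U))`).
* §5 frame constants under the `L²`-operator norm: ★ `abs_trReForm_trBasis_le` (`c_β = 1`) · ★ `norm_trBasis_le` (`n_e = 1`); two private [folklore] helpers.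
* §6 ★★★ `eq324_CsDeltaCY_precision_ofRecordTC_trBasis_on_unit` — THE PRECISION DOOR AT THE RECORD FIBRE: p669260 at `β := trReForm`, `b := trBasis N`,
  `𝔢 := sectELettersYOfRecordTC x 𝔳 𝔢₀`, with (R1′) in `IsSymmTr 1` currency, (R3′) REPLACED by «`V(b) ∈ U(N)` + pivot units», `c_β = n_e = 1` discharged, (R5′) in
  `trIP 1` currency, (R2′)(R4′) verbatim; ★★★ `eq324_CsDeltaCY_precision_sectEYOfRecordV6_trBasis_on_unit` — the same at the v6 instance of record
  (`sectEYOfRecordV6`, `G ≤ U(N)`, `G`-valued `U`: unitarity discharged by `avYOfRecord_mem`); one `example` (scalar side elaborates).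
* §7 ★★★ `eq324_CsDeltaCY_precision_sectEYOfRecordV6_trBasis_of_smallVY_on_unit` — THE DOOR AT THE v6 RECORD IN def-Y's SMALL-FIELD REGIME
  (`SmallVY x (avYOfRecord x) G U δ_V`, `G ≤ U(N)`): (R3′), (R4′) (seat n08-d's p671113 `local_elimCΛY_ofRecordTC` ∕ `colMass_elimCΛY_ofRecordTC_of_smallVY`, by
  name), unitarity, the pivot units and the frame constants ALL DISCHARGED — only node N06's rows (R1′)(R2′)(R5′) stay displayed.
* §8 (v1.1, gen 33 INTENT-9; +2 imports `Node00.OpsYD2JForm`, `Node00.OpsYSectEElimAxial`; doc-only riders: lit-balaban-r06's [B9] numerals (3.35) → p.396, (3.9) → p.392 throughout; ref-C NIT 448a, the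
  NORM DICTIONARY sentence of HONEST SCOPE): `QG1QinvY_isSymmTr_parSymY` ∕ `lettersYOfRecordV4_QG1Qinv_isSymmTr` (def-Y's `QG1QinvY_isSymmTr` at the
  symmetrised tables ∕ the v4 record, the `QG1Qinv` companion of def-Y's `lettersYOfRecordV4_G₁_isSymmTr`); ★★★
  `eq324_CsDeltaCY_precision_opsYOfRecordV8E_trBasis_of_plaqSmall_on_unit` — THE DOOR AT NODE 00's v8 INSTANCE OF RECORD (`lettersYOfRecordV4 … (resYOfC2 𝔠)`,
  `sectEYOfRecordV6 … (sectEYWithDt2 … (resYOfC2 𝔠) 𝔡₂ 𝔢₀)`) UNDER PRINT's SMALL CURVATURE (3.35) (plaquette smallness of the averaged field of record on every double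
  block: pivot units by def-Y `isUnit_KY_KTY_avYOfRecord_of_plaqSmall`, (R4′) by seat n08-d's p672585 `local_elimC_sectEYOfRecordV6` ∕
  `colMass_elimC_sectEYOfRecordV6_of_plaqSmall`), (R1′) DISCHARGED by def-Y's `resYOfC2_Δ2_isSymmTr_real` ∕ `sectEYWithDt2_D2J_isSymmTr_ofC2` modulo [5]'s reality of
  `C⁽²⁾(U)`, `D̃⁽²⁾(U)`; displayed: (R2′) (two kernel readings), (R5′) (`γ₀`), the two reality binders, `G`-valued `U` with `G ≤ U(N)`, the plaquette smallness.
HONEST SCOPE.  Count-neutral finite-dimensional `star`-bookkeeping, one operator-norm computation and compositions BY NAME.  NORM DICTIONARY (ref-C NIT 448a): the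
fibre norm of §5–§8 is the `L²`-OPERATOR norm on `M_N(ℂ)` carried by the record's scoped instances (`Matrix.Norms.L2Operator`), whereas [Balaban1985BackgroundPropagators]
p. 390 fixes the HILBERT–SCHMIDT norm; `c_β = n_e = 1` holds for both, but the displayed rows (R2′)(R4′)(R5′) are norm-sensitive and move by `N`-dependent constants
between the two readings (`‖·‖_op ≤ ‖·‖_HS ≤ √N·‖·‖_op`).  The rows (R2′) (node N06's (3.132)
reading of `(QG₁Q*)⁻¹(U)` and a reading of `a + ⟨D̃⁽²⁾·,J⟩(U)`), (R5′) (`γ₀`, G-B9-09) and the `IsSymmTr 1` binders of (R1′) (node N06 ∕ def-Y theorems at the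
tables of record, not composed here) stay DISPLAYED in every edition; (R4′) and the pivot-unit binders stay displayed at a general `U` (§6) and are discharged
in the small-field regime only (§7; print's regime is small CURVATURE (3.35), reduced to small fields by an axial gauge — def-Y's margin, not formalised); no
letter is pinned or constructed; the IDENT (NODE 00's `(𝔖 k).μ = 𝒩(0, 𝕄_Λ̃(C*Δ_kC)⁻¹).map Φ`, box, class-II Hamiltonian letters, window `b₁ < b₀`) is NOT made, NOT
commissioned, NOT claimed; nothing of [Balaban1985UV3], [Balaban1985BackgroundPropagators], [Balaban1985Averaging], [Balaban1984PropagatorsII], [Balaban1982Higgs1]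
or [BenfattoEtAl1978] is asserted or discharged; node N08 is NOT discharged; nothing about d = 4, the continuum, OS axioms, a mass gap or the Clay problem.
-/

noncomputable section

open Finset Matrix

namespace Literature.MathematicalPhysics.QuantumFieldTheory.Balaban1983to89.B1Eq324BenfattoClassSectEMemberRealAdjointAtNode00

open Literature.MathematicalPhysics.QuantumFieldTheory
open Literature.MathematicalPhysics.QuantumFieldTheory.Balaban1983to89.B9Eq3169Mu (hol trSum hol_cons_apply trSum_cons)
open Literature.MathematicalPhysics.QuantumFieldTheory.Balaban1983to89.B9Eq39Adjoint (R)
open Literature.MathematicalPhysics.QuantumFieldTheory.Balaban1983to89.B9PinMembersKLevelV1 (MemberY)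
open Literature.MathematicalPhysics.QuantumFieldTheory.Balaban1983to89.Node00

variable {d ℓ : ℕ} {hd : 1 ≤ d + 1} {hL : Odd (ℓ + 1) ∧ 1 < ℓ + 1} {b₀ b₁ : ℝ} {Mstar : ℕ}

/-! ## §0  `star` through the (3.169) transports along chains, and through `Ring.inverse` on the fibre -/

section StarChains

variable {𝔸 : Type} [NormedRing 𝔸] [NormedAlgebra ℂ 𝔸] [CompleteSpace 𝔸] [StarRing 𝔸]
variable {Bond : Type}

omit [CompleteSpace 𝔸] in
/-- `star` passes through the composite transport along a chain when it passes through every bond transport. [cite: Balaban1985BackgroundPropagators, p.390–391 (R(U) on hermitian matrices), bookkeeping] -/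
theorem star_hol_apply (T : Bond → 𝔸 ≃ₗ[ℝ] 𝔸) (hT : ∀ b v, star (T b v) = T b (star v)) :
    ∀ (Γ : List Bond) (v : 𝔸), star (hol T Γ v) = hol T Γ (star v)
  | [], _ => rfl
  | b :: Γ, v => by rw [hol_cons_apply, hol_cons_apply, hT, star_hol_apply T hT Γ]

omit [CompleteSpace 𝔸] in
/-- `star` passes through the inverse composite transport. [cite: Balaban1985BackgroundPropagators, p.390–391, bookkeeping] -/
theorem star_hol_symm_apply (T : Bond → 𝔸 ≃ₗ[ℝ] 𝔸) (hT : ∀ b v, star (T b v) = T b (star v)) (Γ : List Bond) (v : 𝔸) :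
    star ((hol T Γ).symm v) = (hol T Γ).symm (star v) := by
  apply (hol T Γ).injective
  rw [LinearEquiv.apply_symm_apply, ← star_hol_apply T hT Γ, LinearEquiv.apply_symm_apply]

omit [CompleteSpace 𝔸] in
/-- `star` passes through the transported sum (3.169) along a chain. [cite: Balaban1985BackgroundPropagators, (3.169) p.430, bookkeeping] -/
theorem star_trSum (T : Bond → 𝔸 ≃ₗ[ℝ] 𝔸) (hT : ∀ b v, star (T b v) = T b (star v)) (B : Bond → 𝔸) :
    ∀ Γ : List Bond, star (trSum T B Γ) = trSum T (star B) Γ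
  | [] => by rw [B9Eq3169Mu.trSum_nil, B9Eq3169Mu.trSum_nil, star_zero]
  | b :: Γ => by rw [trSum_cons, trSum_cons, star_add, hT, star_trSum T hT B Γ, Pi.star_apply]

omit [CompleteSpace 𝔸] in
/-- `star` passes through the transpose of the transported sum. [cite: Balaban1985BackgroundPropagators, (3.169) p.430, (3.9) p.392, bookkeeping] -/
theorem star_trSumT [DecidableEq Bond] (S : Bond → 𝔸 ≃ₗ[ℝ] 𝔸) (hS : ∀ b v, star (S b v) = S b (star v)) :
    ∀ (Γ : List Bond) (v : 𝔸), star (trSumT S Γ v) = trSumT S Γ (star v)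
  | [], _ => by rw [trSumT_nil, trSumT_nil, star_zero]
  | b :: Γ, v => by
      rw [trSumT_cons, trSumT_cons, star_add, star_trSumT S hS Γ, hS]
      congr 1
      funext q
      simp only [Pi.star_apply, sglY_apply]
      split_ifs
      · rfl
      · rw [star_zero]

omit [CompleteSpace 𝔸] in
/-- ★ **THE INVERSE OF A REAL ENDOMORPHISM OF THE FIBRE IS REAL** (total `Ring.inverse` on `Module.End ℂ 𝔸`; the fibre twin of def-Y's
`IsRealOpY.ringInverse`). [cite: Balaban1985BackgroundPropagators, p.428 («a solution of the equation (QB)(c) = 0»), bookkeeping] -/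
theorem star_ringInverse_apply (K : Module.End ℂ 𝔸) (hK : ∀ a, star (K a) = K (star a)) (a : 𝔸) :
    star (Ring.inverse K a) = Ring.inverse K (star a) := by
  by_cases hu : IsUnit K
  · obtain ⟨u, rfl⟩ := hu
    rw [Ring.inverse_unit]
    have h1 : (u : Module.End ℂ 𝔸) (star ((↑u⁻¹ : Module.End ℂ 𝔸) a)) = star a := by
      rw [← hK, ← Module.End.mul_apply, Units.mul_inv, Module.End.one_apply]
    calc star ((↑u⁻¹ : Module.End ℂ 𝔸) a)
        = (↑u⁻¹ : Module.End ℂ 𝔸) ((u : Module.End ℂ 𝔸) (star ((↑u⁻¹ : Module.End ℂ 𝔸) a))) := by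
          rw [← Module.End.mul_apply, Units.inv_mul, Module.End.one_apply]
      _ = (↑u⁻¹ : Module.End ℂ 𝔸) (star a) := by rw [h1]
  · rw [Ring.inverse_non_unit _ hu, LinearMap.zero_apply, LinearMap.zero_apply, star_zero]

end StarChains

/-! ## §1  A flat-trace adjoint pair with a real partner is a `trReForm`-adjoint pair (fibre `M_N(ℂ)`) -/

section Bridge

open B9Thm311ReadingCoords (trIP IsAdjTr trIP_eq_re_trace)
open B9CoReadingCoordsTranspose (trReForm trReForm_apply)

variable {N : ℕ} {X : Type} [Fintype X]

/-- ★★ **A FLAT-TRACE ADJOINT PAIR WITH A REAL PARTNER IS AN ADJOINT PAIR FOR THE HERMITIAN TRACE PAIRING, IN THE DOOR's SHAPE**: if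
`Σ_q tr((CB)(q)·A(q)) = Σ_q tr(B(q)·(C†A)(q))` (def-Y's flat transposition, `Node00.sum_tr_elimCY_mul`) and `C†` commutes with the pointwise conjugate
transpose, then `Σ_u Re tr((Ψu)ᴴ·(CΦ)(u)) = Σ_u Re tr(((C†Ψ)(u))ᴴ·Φ(u))` — hypothesis (R3′) of p669260 `eq324_CsDeltaCY_precision_node00_on_unit` at
`β := trReForm`. (The adjoint-pair twin of def-Y's `OpsYDelta2Form.isSymmTr_of_trSymm_of_real`.) [cite: Balaban1985BackgroundPropagators, (3.157) p.428 («C*»), (3.9) p.392, p.391 (hermitian-valued functions), bookkeeping] -/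
theorem sum_trReForm_adjoint_of_trace_transpose_of_real (C Ct : (X → Matrix (Fin N) (Fin N) ℂ) →ₗ[ℂ] (X → Matrix (Fin N) (Fin N) ℂ))
    (htr : ∀ B A : X → Matrix (Fin N) (Fin N) ℂ, ∑ q, Matrix.trace (C B q * A q) = ∑ q, Matrix.trace (B q * Ct A q))
    (hreal : IsRealOpY Ct) (Φ Ψ : X → Matrix (Fin N) (Fin N) ℂ) :
    ∑ u, trReForm (Ψ u) ((C.restrictScalars ℝ) Φ u) = ∑ u, trReForm ((Ct.restrictScalars ℝ) Ψ u) (Φ u) := by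
  simp only [LinearMap.restrictScalars_apply, trReForm_apply]
  rw [← Complex.re_sum, ← Complex.re_sum]
  congr 1
  have h := htr Φ (star Ψ)
  rw [hreal.apply] at h
  calc ∑ u, Matrix.trace ((Ψ u)ᴴ * C Φ u) = ∑ u, Matrix.trace (C Φ u * (star Ψ) u) :=
        Finset.sum_congr rfl fun u _ => by rw [Pi.star_apply, Matrix.star_eq_conjTranspose, Matrix.trace_mul_comm]
    _ = ∑ u, Matrix.trace (Φ u * (star (Ct Ψ)) u) := h
    _ = ∑ u, Matrix.trace ((Ct Ψ u)ᴴ * Φ u) :=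
        Finset.sum_congr rfl fun u _ => by rw [Pi.star_apply, Matrix.star_eq_conjTranspose, Matrix.trace_mul_comm]

/-- ★ the same in seat n06-j's currency: `IsAdjTr 1 1 C C†`. [cite: Balaban1985BackgroundPropagators, p.393 (adjoints for the scalar products), (3.157) p.428, bookkeeping] -/
theorem isAdjTr_of_trace_transpose_of_real (C Ct : (X → Matrix (Fin N) (Fin N) ℂ) →ₗ[ℂ] (X → Matrix (Fin N) (Fin N) ℂ))
    (htr : ∀ B A : X → Matrix (Fin N) (Fin N) ℂ, ∑ q, Matrix.trace (C B q * A q) = ∑ q, Matrix.trace (B q * Ct A q))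
    (hreal : IsRealOpY Ct) : IsAdjTr (fun _ => (1 : ℝ)) (fun _ => (1 : ℝ)) C Ct := by
  intro Φ Ψ
  rw [trIP_eq_re_trace, trIP_eq_re_trace]
  simp only [one_mul]
  have h := sum_trReForm_adjoint_of_trace_transpose_of_real C Ct htr hreal Φ Ψ
  simp only [LinearMap.restrictScalars_apply, trReForm_apply] at h
  -- `Re tr((CΦ)ᴴ Ψ) = Re tr(Ψᴴ (CΦ))` (conjugate), and likewise on the right
  have hl : ∀ u, (Matrix.trace ((C Φ u)ᴴ * Ψ u)).re = (Matrix.trace ((Ψ u)ᴴ * C Φ u)).re := fun u => by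
    rw [← trReForm_apply, ← trReForm_apply, B9CoReadingCoordsTranspose.trReForm_symm]
  have hr : ∀ u, (Matrix.trace ((Φ u)ᴴ * Ct Ψ u)).re = (Matrix.trace ((Ct Ψ u)ᴴ * Φ u)).re := fun u => by
    rw [← trReForm_apply, ← trReForm_apply, B9CoReadingCoordsTranspose.trReForm_symm]
  simp only [hl, hr]
  exact h

end Bridge

/-! ## §2  REALITY of the (3.157) letters `C(V) = elimCY`, `C(V)* = elimCtY` at a star-unitary averaged field -/

section Reality

open B9Eq310Hermitian (star_R unitary_inv)

variable {𝔸 : Type} [NormedRing 𝔸] [NormedAlgebra ℂ 𝔸] [CompleteSpace 𝔸] [StarRing 𝔸] [StarModule ℂ 𝔸]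
variable (x : MemberY d ℓ hd hL b₀ b₁ Mstar) (𝔳 : AvY 𝔸 x) {U : CfgY 𝔸 x.toKIdx}

omit [NormedAlgebra ℂ 𝔸] [CompleteSpace 𝔸] [StarModule ℂ 𝔸] in
/-- reading on the unit bonds commutes with `star`. [cite: Balaban1984PropagatorsII, (2.3) p.224; Balaban1985BackgroundPropagators, p.391, bookkeeping] -/
theorem star_readUY (B : IBondY x.toKIdx → 𝔸) : star (readUY x B) = readUY x (star B) := by
  funext b
  rw [Pi.star_apply]
  by_cases h : b.src ∈ (B6GlobalChartV1.domT x.hN x.D x.hk).Om x.k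
  · rw [readUY_apply_of_mem x _ h, readUY_apply_of_mem x _ h, Pi.star_apply]
  · rw [readUY_apply_of_not_mem x _ h, readUY_apply_of_not_mem x _ h, star_zero]

omit [NormedAlgebra ℂ 𝔸] [CompleteSpace 𝔸] [StarModule ℂ 𝔸] in
/-- placing on the index bonds commutes with `star`. [cite: Balaban1984PropagatorsII, (2.3) p.224; Balaban1985BackgroundPropagators, (3.9) p.392, bookkeeping] -/
theorem star_placeUY (W : UBondY x → 𝔸) : star (placeUY x W) = placeUY x (star W) := by
  classical
  funext q
  rw [Pi.star_apply]
  unfold placeUY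
  rw [star_sum]
  refine Finset.sum_congr rfl fun b _ => ?_
  split_ifs
  · rw [Pi.star_apply]
  · rw [star_zero]
  · rw [star_zero]

omit [CompleteSpace 𝔸] [StarModule ℂ 𝔸] in
/-- restriction to a sector commutes with `star`. [cite: Balaban1985BackgroundPropagators, p.428 («B = 0 on Λᶜ»), bookkeeping] -/
theorem star_secY_apply (S : IBondY x.toKIdx → Prop) (B : IBondY x.toKIdx → 𝔸) (q : IBondY x.toKIdx) :
    star (secY 𝔸 S B q) = secY 𝔸 S (star B) q := by
  by_cases h : S q
  · rw [secY_apply_of h, secY_apply_of h, Pi.star_apply]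
  · rw [secY_apply_of_not h, secY_apply_of_not h, star_zero]

omit [CompleteSpace 𝔸] [StarModule ℂ 𝔸] in
/-- `P_S` is a real operator. [cite: Balaban1985BackgroundPropagators, p.428, p.391, bookkeeping] -/
theorem secY_isRealOpY (S : IBondY x.toKIdx → Prop) : IsRealOpY (secY 𝔸 S : Module.End ℂ (IBondY x.toKIdx → 𝔸)) := fun B => by
  funext q; rw [Pi.star_apply, star_secY_apply]

/-- the normalisation `L^{−(d+2)}` of (125) is real. [cite: Balaban1985Averaging, (125) p.36, bookkeeping] -/
theorem star_qNormY : star (qNormY d ℓ) = qNormY d ℓ := by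
  unfold qNormY
  rw [Complex.star_def, map_inv₀, map_pow, Complex.conj_natCast]

variable (h𝔳 : ∀ b : UBondY x, (((𝔳 U b)⁻¹ : 𝔸ˣ) : 𝔸) = star ((𝔳 U b : 𝔸ˣ) : 𝔸))
include h𝔳

omit [StarModule ℂ 𝔸] in
/-- the unit-bond transports `Ad V(b)` commute with `star` at a star-unitary `V` (pv27 `star_R`). [cite: Balaban1985Averaging, (56) p.27; Balaban1985BackgroundPropagators, p.390–391] -/
theorem star_RUY (b : UBondY x) (v : 𝔸) : star (RUY x 𝔳 U b v) = RUY x 𝔳 U b (star v) := by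
  rw [RUY_apply]; exact star_R (h𝔳 b) v

omit [StarModule ℂ 𝔸] in
/-- the adjoint unit-bond transports `Ad V(b)⁻¹` commute with `star`. [cite: Balaban1985Averaging, (57) p.27; Balaban1985BackgroundPropagators, p.390–391] -/
theorem star_RUTY (b : UBondY x) (v : 𝔸) : star (RUTY x 𝔳 U b v) = RUTY x 𝔳 U b (star v) := by
  rw [RUTY_apply]; exact star_R (unitary_inv (h𝔳 b)) v

omit [StarModule ℂ 𝔸] in
/-- the block-contour transports of record commute with `star`. [cite: Balaban1985BackgroundPropagators, (3.168) p.430, p.390–391] -/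
theorem star_RVY (q : IBondY x.toKIdx) (v : 𝔸) : star (RVY x 𝔳 U q v) = RVY x 𝔳 U q (star v) := by
  rw [RVY_apply]; exact star_R (h𝔳 _) v

omit [StarModule ℂ 𝔸] in
/-- (125) before normalisation commutes with `star`. [cite: Balaban1985Averaging, (125) p.36; Balaban1985BackgroundPropagators, p.391] -/
theorem star_q1FunY (B : IBondY x.toKIdx → 𝔸) (c : USiteY x × Fin (d + 1)) : star (q1FunY x 𝔳 U B c) = q1FunY x 𝔳 U (star B) c := by
  unfold q1FunY
  rw [star_sum]
  refine Finset.sum_congr rfl fun z _ => ?_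
  rw [star_hol_apply _ (star_RVY x 𝔳 h𝔳), star_trSum _ (star_RUY x 𝔳 h𝔳), star_readUY]

/-- ★ **`Q(V)` OF (125) IS REAL**: `(Q(V)B⋆)(c) = ((Q(V)B)(c))⋆`. [cite: Balaban1985Averaging, (125) p.36; Balaban1985BackgroundPropagators, (3.157) p.428, p.391] -/
theorem star_Q1Y (c : USiteY x × Fin (d + 1)) (B : IBondY x.toKIdx → 𝔸) : star (Q1Y x 𝔳 U c B) = Q1Y x 𝔳 U c (star B) := by
  show star (qNormY d ℓ • q1FunY x 𝔳 U B c) = qNormY d ℓ • q1FunY x 𝔳 U (star B) c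
  rw [star_smul, star_qNormY, star_q1FunY x 𝔳 h𝔳]

/-- ★ **THE PIVOT COEFFICIENT `K_c(V)` IS REAL**. [cite: Balaban1985BackgroundPropagators, p.428 («an equation on the variable B(b₀)»), p.391] -/
theorem star_KY (c : CBondY x) (a : 𝔸) : star (KY x 𝔳 U c a) = KY x 𝔳 U c (star a) := by
  rw [KY_apply, KY_apply, star_Q1Y x 𝔳 h𝔳, ← Pi.single_star]

/-- ★★ **THE LETTER `C(V)` OF (3.157) IS A REAL OPERATOR** at a star-unitary averaged field: `C(V)(B⋆) = (C(V)B)⋆` — print's operators act on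
hermitian-(`𝔤`-)valued bond functions. [cite: Balaban1985BackgroundPropagators, (3.157) p.428, p.389 («values in the Lie algebra 𝔤»), p.391] -/
theorem elimCY_isRealOpY : IsRealOpY (elimCY x 𝔳 U) := by
  intro B
  funext q
  rw [Pi.star_apply, elimCY_apply, elimCY_apply, star_sub, star_sum, star_secY_apply]
  congr 1
  refine Finset.sum_congr rfl fun c _ => ?_
  split_ifs
  · rw [star_ringInverse_apply _ (star_KY x 𝔳 h𝔳 c), star_Q1Y x 𝔳 h𝔳, (secY_isRealOpY x (lamTY x)).apply]
  · rw [star_zero]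

omit [StarModule ℂ 𝔸] in
/-- the transpose of (125) before normalisation commutes with `star`. [cite: Balaban1985Averaging, (125) p.36; Balaban1985BackgroundPropagators, (3.9) p.392] -/
theorem star_q1TFunY (c : USiteY x × Fin (d + 1)) (v : 𝔸) : star (q1TFunY x 𝔳 U c v) = q1TFunY x 𝔳 U c (star v) := by
  classical
  unfold q1TFunY
  rw [star_sum]
  refine Finset.sum_congr rfl fun z _ => ?_
  rw [star_placeUY, star_trSumT _ (star_RUTY x 𝔳 h𝔳), star_hol_symm_apply _ (star_RVY x 𝔳 h𝔳)]

/-- ★ **`Q(V)*` IS REAL**. [cite: Balaban1985BackgroundPropagators, (3.157) p.428 («C*»), (3.9) p.392] -/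
theorem star_Q1TY (c : USiteY x × Fin (d + 1)) (v : 𝔸) : star (Q1TY x 𝔳 U c v) = Q1TY x 𝔳 U c (star v) := by
  rw [Q1TY_apply, Q1TY_apply, star_smul, star_qNormY, star_q1TFunY x 𝔳 h𝔳]

/-- ★ **`K_c(V)*` IS REAL**. [cite: Balaban1985BackgroundPropagators, p.428, (3.9) p.392] -/
theorem star_KTY (c : CBondY x) (v : 𝔸) : star (KTY x 𝔳 U c v) = KTY x 𝔳 U c (star v) := by
  rw [KTY_apply, KTY_apply, ← Pi.star_apply (Q1TY x 𝔳 U c.1 v), star_Q1TY x 𝔳 h𝔳]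

/-- ★★ **THE LETTER `C(V)*` OF (3.157) IS A REAL OPERATOR** at a star-unitary averaged field. [cite: Balaban1985BackgroundPropagators, (3.157) p.428 («C*g»), (3.9) p.392] -/
theorem elimCtY_isRealOpY : IsRealOpY (elimCtY x 𝔳 U) := by
  classical
  intro A
  funext q
  rw [Pi.star_apply, elimCtY_eq, elimCtY_eq, Pi.sub_apply, Pi.sub_apply, star_sub, Finset.sum_apply, Finset.sum_apply, star_sum,
    star_secY_apply]
  congr 1
  refine Finset.sum_congr rfl fun c _ => ?_
  rw [star_secY_apply, star_Q1TY x 𝔳 h𝔳, star_ringInverse_apply _ (star_KTY x 𝔳 h𝔳 c), Pi.star_apply]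

end Reality

/-! ## §3  (R3′) AT NODE 00's GENUINE `C(V) ∕ C(V)*` OF RECORD (fibre `M_N(ℂ)`): the `trReForm`-adjointness of `elimCΛY ∕ elimCtΛY` -/

section RecordAdjoint

open scoped Matrix.Norms.L2Operator
open B7Prop2Explicit (unitaryUnits)
open B9Thm311ReadingCoords (trIP IsSymmTr IsAdjTr)
open B9CoReadingCoordsTranspose (trReForm)

variable {N : ℕ} (x : MemberY d ℓ hd hL b₀ b₁ Mstar) (𝔳 : AvY (Matrix (Fin N) (Fin N) ℂ) x) {U : CfgY (Matrix (Fin N) (Fin N) ℂ) x.toKIdx}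

/-- ★★ `C(V)` IS REAL at a unitary-valued averaged field (`V(b) ∈ U(N)`). [cite: Balaban1985BackgroundPropagators, (3.157) p.428, p.390 (G ⊂ U(N)), p.391] -/
theorem elimCY_isRealOpY_of_unitary
    (h𝔳 : ∀ b : UBondY x, ((𝔳 U b : (Matrix (Fin N) (Fin N) ℂ)ˣ) : Matrix (Fin N) (Fin N) ℂ) ∈ unitary (Matrix (Fin N) (Fin N) ℂ)) :
    IsRealOpY (elimCY x 𝔳 U) :=
  elimCY_isRealOpY x 𝔳 fun b => inv_eq_star_of_mem_unitary (h𝔳 b)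

/-- ★★ `C(V)*` IS REAL at a unitary-valued averaged field. [cite: Balaban1985BackgroundPropagators, (3.157) p.428 («C*»), p.390, p.391] -/
theorem elimCtY_isRealOpY_of_unitary
    (h𝔳 : ∀ b : UBondY x, ((𝔳 U b : (Matrix (Fin N) (Fin N) ℂ)ˣ) : Matrix (Fin N) (Fin N) ℂ) ∈ unitary (Matrix (Fin N) (Fin N) ℂ)) :
    IsRealOpY (elimCtY x 𝔳 U) :=
  elimCtY_isRealOpY x 𝔳 fun b => inv_eq_star_of_mem_unitary (h𝔳 b)

/-- `C(V)` of the averaged field OF RECORD is real at a `G`-valued background, `G ≤ U(N)`. [cite: Balaban1985BackgroundPropagators, (3.157) p.428, (3.40) p.397] -/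
theorem elimCY_avYOfRecord_isRealOpY {G : Subgroup (Matrix (Fin N) (Fin N) ℂ)ˣ} (hG : G ≤ unitaryUnits (Matrix (Fin N) (Fin N) ℂ))
    (hU : ∀ μ z, U μ z ∈ G) : IsRealOpY (elimCY x (avYOfRecord x) U) :=
  elimCY_isRealOpY_of_unitary x _ fun b => B7Prop2Explicit.mem_unitaryUnits.mp (hG (avYOfRecord_mem x hU b))

/-- `C(V)*` of the averaged field OF RECORD is real at a `G`-valued background, `G ≤ U(N)`. [cite: Balaban1985BackgroundPropagators, (3.157) p.428, (3.40) p.397] -/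
theorem elimCtY_avYOfRecord_isRealOpY {G : Subgroup (Matrix (Fin N) (Fin N) ℂ)ˣ} (hG : G ≤ unitaryUnits (Matrix (Fin N) (Fin N) ℂ))
    (hU : ∀ μ z, U μ z ∈ G) : IsRealOpY (elimCtY x (avYOfRecord x) U) :=
  elimCtY_isRealOpY_of_unitary x _ fun b => B7Prop2Explicit.mem_unitaryUnits.mp (hG (avYOfRecord_mem x hU b))

/-- ★★ `C(V) ∕ C(V)*` IS AN ADJOINT PAIR FOR THE HERMITIAN TRACE PAIRING (seat n06-j's `IsAdjTr 1 1`) at a unitary-valued averaged field whose pivot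
coefficients and their transposes are units. [cite: Balaban1985BackgroundPropagators, (3.157) p.428 («C*»), (3.9) p.392, p.393] -/
theorem isAdjTr_elimCY_elimCtY
    (h𝔳 : ∀ b : UBondY x, ((𝔳 U b : (Matrix (Fin N) (Fin N) ℂ)ˣ) : Matrix (Fin N) (Fin N) ℂ) ∈ unitary (Matrix (Fin N) (Fin N) ℂ))
    (hK : ∀ c : CBondY x, IsUnit (KY x 𝔳 U c)) (hKT : ∀ c : CBondY x, IsUnit (KTY x 𝔳 U c)) :
    IsAdjTr (fun _ => (1 : ℝ)) (fun _ => (1 : ℝ)) (elimCY x 𝔳 U) (elimCtY x 𝔳 U) :=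
  isAdjTr_of_trace_transpose_of_real _ _
    (fun B A => sum_tr_elimCY_mul x 𝔳 (Matrix.traceLinearMap (Fin N) ℂ ℂ) (fun a b => Matrix.trace_mul_comm a b) U hK hKT B A)
    (elimCtY_isRealOpY_of_unitary x 𝔳 h𝔳)

/-- ★★★ **(R3′) OF THE PRECISION DOOR AT THE SEVEN-LETTER RECORD**: at `𝔢 := sectELettersYOfRecordTC x 𝔳 𝔢₀` (whose dressed `P_Λ C P_Λ̃ ∕ P_Λ̃ C* P_Λ` ARE
`C(V) ∕ C(V)*`, def-Y `elimCΛY_sectELettersYOfRecordTC`), for a unitary-valued averaged field with unit pivot coefficients, the hypothesis `hCadj` of p669260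
`eq324_CsDeltaCY_precision_node00_on_unit` at `β := trReForm` HOLDS: `Σ_u Re tr((Ψu)ᴴ (P_Λ C P_Λ̃ Φ)(u)) = Σ_u Re tr(((P_Λ̃ C* P_Λ Ψ)(u))ᴴ Φ(u))`.
[cite: Balaban1985BackgroundPropagators, (3.157) p.428 («B = CB̃ … C*g»), (3.9) p.392, p.391 (hermitian-valued functions)] -/
theorem sum_trReForm_elimCΛY_ofRecordTC (𝔢₀ : SectELettersY (Matrix (Fin N) (Fin N) ℂ) x)
    (h𝔳 : ∀ b : UBondY x, ((𝔳 U b : (Matrix (Fin N) (Fin N) ℂ)ˣ) : Matrix (Fin N) (Fin N) ℂ) ∈ unitary (Matrix (Fin N) (Fin N) ℂ))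
    (hK : ∀ c : CBondY x, IsUnit (KY x 𝔳 U c)) (hKT : ∀ c : CBondY x, IsUnit (KTY x 𝔳 U c))
    (Φ Ψ : IBondY x.toKIdx → Matrix (Fin N) (Fin N) ℂ) :
    ∑ u, trReForm (Ψ u) (((elimCΛY x (sectELettersYOfRecordTC x 𝔳 𝔢₀) U).restrictScalars ℝ) Φ u) =
      ∑ u, trReForm (((elimCtΛY x (sectELettersYOfRecordTC x 𝔳 𝔢₀) U).restrictScalars ℝ) Ψ u) (Φ u) := by
  rw [elimCΛY_sectELettersYOfRecordTC, elimCtΛY_sectELettersYOfRecordTC]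
  exact sum_trReForm_adjoint_of_trace_transpose_of_real _ _
    (fun B A => sum_tr_elimCY_mul x 𝔳 (Matrix.traceLinearMap (Fin N) ℂ ℂ) (fun a b => Matrix.trace_mul_comm a b) U hK hKT B A)
    (elimCtY_isRealOpY_of_unitary x 𝔳 h𝔳) Φ Ψ

/-- ★★ **(R3′) AT THE SEVEN-LETTER RECORD IN def-Y's SMALL-FIELD REGIME — NO `IsUnit` HYPOTHESES** (`SmallVY`, `G ≤ U(N)`).
[cite: Balaban1985BackgroundPropagators, (3.157) p.428, (3.35) p.396, (3.9) p.392] -/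
theorem sum_trReForm_elimCΛY_ofRecordTC_of_smallVY (𝔢₀ : SectELettersY (Matrix (Fin N) (Fin N) ℂ) x)
    {G : Subgroup (Matrix (Fin N) (Fin N) ℂ)ˣ} (hG : G ≤ unitaryUnits (Matrix (Fin N) (Fin N) ℂ)) {δ : ℝ} (hs : SmallVY x 𝔳 G U δ)
    (Φ Ψ : IBondY x.toKIdx → Matrix (Fin N) (Fin N) ℂ) :
    ∑ u, trReForm (Ψ u) (((elimCΛY x (sectELettersYOfRecordTC x 𝔳 𝔢₀) U).restrictScalars ℝ) Φ u) =
      ∑ u, trReForm (((elimCtΛY x (sectELettersYOfRecordTC x 𝔳 𝔢₀) U).restrictScalars ℝ) Ψ u) (Φ u) :=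
  sum_trReForm_elimCΛY_ofRecordTC x 𝔳 𝔢₀ (fun b => B7Prop2Explicit.mem_unitaryUnits.mp (hG (hs.2.1 b))) (isUnit_KY_of_smallVY x 𝔳 hs)
    (isUnit_KTY_of_smallVY x 𝔳 hs) Φ Ψ

/-- ★★ **(R3′) AT THE SEVEN-LETTER RECORD OF THE AVERAGED FIELD OF RECORD AT `U = 1` — HYPOTHESIS-FREE** (def-Y `isUnit_KY_one ∕ isUnit_KTY_one`,
`avYOfRecord_one`). [cite: Balaban1985BackgroundPropagators, (3.157) p.428, p.395 (U = 1); Balaban1984PropagatorsII, (2.154)–(2.156) pp.249–250] -/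
theorem sum_trReForm_elimCΛY_ofRecordTC_one (𝔢₀ : SectELettersY (Matrix (Fin N) (Fin N) ℂ) x) (Φ Ψ : IBondY x.toKIdx → Matrix (Fin N) (Fin N) ℂ) :
    ∑ u, trReForm (Ψ u) (((elimCΛY x (sectELettersYOfRecordTC x (avYOfRecord x) 𝔢₀)
        (fun _ _ => 1 : CfgY (Matrix (Fin N) (Fin N) ℂ) x.toKIdx)).restrictScalars ℝ) Φ u) =
      ∑ u, trReForm (((elimCtΛY x (sectELettersYOfRecordTC x (avYOfRecord x) 𝔢₀)
        (fun _ _ => 1 : CfgY (Matrix (Fin N) (Fin N) ℂ) x.toKIdx)).restrictScalars ℝ) Ψ u) (Φ u) :=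
  sum_trReForm_elimCΛY_ofRecordTC x (avYOfRecord x) 𝔢₀ (fun b => by rw [avYOfRecord_one, Units.val_one]; exact Submonoid.one_mem _)
    (fun c => isUnit_KY_one x c) (fun c => isUnit_KTY_one x c) Φ Ψ

variable (N) (θ : Stage3Params) (Mstar' : ℕ) (𝔢₀ : SectEY N θ Mstar')

/-- ★★ **(R3′) AT THE v6 INSTANCE OF RECORD** (`sectEYOfRecordV6`, def-Y FILE 13 §6): `G ≤ U(N)`, `G`-valued `U`, unit pivot coefficients of `V = avYOfRecord x U`.
[cite: Balaban1985BackgroundPropagators, (3.157) p.428, (3.40) p.397, (3.9) p.392] -/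
theorem sum_trReForm_elimCΛY_sectEYOfRecordV6 (x : MemberY θ.d₆ θ.ℓ₆ θ.hd' θ.hL' θ.b₀ θ.b₁ Mstar')
    {G : Subgroup (Matrix (Fin N) (Fin N) ℂ)ˣ} (hG : G ≤ unitaryUnits (Matrix (Fin N) (Fin N) ℂ)) {U : CfgY (Matrix (Fin N) (Fin N) ℂ) x.toKIdx}
    (hU : ∀ μ z, U μ z ∈ G) (hK : ∀ c : CBondY x, IsUnit (KY x (avYOfRecord x) U c)) (hKT : ∀ c : CBondY x, IsUnit (KTY x (avYOfRecord x) U c))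
    (Φ Ψ : IBondY x.toKIdx → Matrix (Fin N) (Fin N) ℂ) :
    ∑ u, trReForm (Ψ u) (((elimCΛY x (sectEYOfRecordV6 N θ Mstar' 𝔢₀ x) U).restrictScalars ℝ) Φ u) =
      ∑ u, trReForm (((elimCtΛY x (sectEYOfRecordV6 N θ Mstar' 𝔢₀ x) U).restrictScalars ℝ) Ψ u) (Φ u) :=
  sum_trReForm_elimCΛY_ofRecordTC x (avYOfRecord x) (𝔢₀ x) (fun b => B7Prop2Explicit.mem_unitaryUnits.mp (hG (avYOfRecord_mem x hU b))) hK hKT Φ Ψ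

/-- ★★ **(R3′) AT THE v6 INSTANCE OF RECORD IN THE SMALL-FIELD REGIME — NO `IsUnit` HYPOTHESES**. [cite: Balaban1985BackgroundPropagators, (3.157) p.428, (3.35) p.396] -/
theorem sum_trReForm_elimCΛY_sectEYOfRecordV6_of_smallVY (x : MemberY θ.d₆ θ.ℓ₆ θ.hd' θ.hL' θ.b₀ θ.b₁ Mstar')
    {G : Subgroup (Matrix (Fin N) (Fin N) ℂ)ˣ} (hG : G ≤ unitaryUnits (Matrix (Fin N) (Fin N) ℂ)) {U : CfgY (Matrix (Fin N) (Fin N) ℂ) x.toKIdx} {δ : ℝ}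
    (hs : SmallVY x (avYOfRecord x) G U δ) (Φ Ψ : IBondY x.toKIdx → Matrix (Fin N) (Fin N) ℂ) :
    ∑ u, trReForm (Ψ u) (((elimCΛY x (sectEYOfRecordV6 N θ Mstar' 𝔢₀ x) U).restrictScalars ℝ) Φ u) =
      ∑ u, trReForm (((elimCtΛY x (sectEYOfRecordV6 N θ Mstar' 𝔢₀ x) U).restrictScalars ℝ) Ψ u) (Φ u) :=
  sum_trReForm_elimCΛY_ofRecordTC_of_smallVY x (avYOfRecord x) (𝔢₀ x) hG hs Φ Ψ

end RecordAdjoint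

/-! ## §4  (R1′) from seat n06-j's `IsSymmTr 1`; the weight letter `a` is symmetric -/

section SymmRows

open scoped Matrix.Norms.L2Operator
open B9Thm311ReadingCoords (trIP IsSymmTr)
open B9CoReadingCoordsTranspose (trReForm)
open B6KLevelCensusIndexV1 (KIdx)
open B1Eq324BenfattoClassSectEMemberCoRead (selfAdjoint_of_isSymmTr)

variable {N : ℕ}

/-- the weight letter `a` of (3.26) ∕ (3.156) is symmetric for the Hermitian trace pairing (a lift of the diagonal real matrix `aK`; n06-j's
`isSymmTr_liftOpY` + `aK_isSymm`). [cite: Balaban1985BackgroundPropagators, (3.26) p.395, (3.156) p.428] -/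
theorem isSymmTr_aY (i : KIdx d ℓ hd hL b₀ b₁) :
    IsSymmTr (fun _ => (1 : ℝ)) (aY i : (IBondY i → Matrix (Fin N) (Fin N) ℂ) →ₗ[ℂ] (IBondY i → Matrix (Fin N) (Fin N) ℂ)) :=
  B9Thm311InputsAtOne.isSymmTr_liftOpY (aK i) (B9Thm311AdjointPairs.aK_isSymm i)

variable (x : MemberY d ℓ hd hL b₀ b₁ Mstar) {U : CfgY (Matrix (Fin N) (Fin N) ℂ) x.toKIdx}

/-- `a + ⟨D̃⁽²⁾·, J⟩(U)` is symmetric as soon as `⟨D̃⁽²⁾·, J⟩(U)` is (def-Y `OpsYD2JForm.sectEYWithDt2_D2J_isSymmTr` at the record).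
[cite: Balaban1985BackgroundPropagators, (3.156) p.428, Thm 3.11 p.416 («symmetric»)] -/
theorem isSymmTr_aY_add_D2J (𝔢 : SectELettersY (Matrix (Fin N) (Fin N) ℂ) x) (hJ : IsSymmTr (fun _ => (1 : ℝ)) (𝔢.D2J U)) :
    IsSymmTr (fun _ => (1 : ℝ)) (aY x.toKIdx + 𝔢.D2J U) :=
  B9Thm311DeltaPrimeSymm.isSymmTr_add _ (isSymmTr_aY x.toKIdx) hJ

/-- ★ **(R1′a) OF THE PRECISION DOOR FROM N06's `IsSymmTr 1 ((QG₁Q*)⁻¹(U))`** (def-Y `QG1QinvY_isSymmTr` at the covariance letters of record): the door's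
β-self-adjointness shape at `β := trReForm`. [cite: Balaban1985BackgroundPropagators, (3.132) p.422, Thm 3.11 p.416 («symmetric»), (3.156) p.428] -/
theorem selfAdjoint_QG1Qinv_of_isSymmTr (𝔏 : CovLettersY (Matrix (Fin N) (Fin N) ℂ) x) (hP : IsSymmTr (fun _ => (1 : ℝ)) (𝔏.QG1Qinv U))
    (Φ Ψ : IBondY x.toKIdx → Matrix (Fin N) (Fin N) ℂ) :
    ∑ u, trReForm (Ψ u) (((𝔏.QG1Qinv U).restrictScalars ℝ) Φ u) = ∑ u, trReForm (((𝔏.QG1Qinv U).restrictScalars ℝ) Ψ u) (Φ u) :=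
  selfAdjoint_of_isSymmTr _ hP Φ Ψ

/-- ★ **(R1′b) OF THE PRECISION DOOR FROM `IsSymmTr 1 (⟨D̃⁽²⁾·, J⟩(U))`**: the door's β-self-adjointness shape for `a + ⟨D̃⁽²⁾·, J⟩(U)` at `β := trReForm`.
[cite: Balaban1985BackgroundPropagators, (3.156) p.428, Thm 3.11 p.416] -/
theorem selfAdjoint_aY_add_D2J_of_isSymmTr (𝔢 : SectELettersY (Matrix (Fin N) (Fin N) ℂ) x) (hJ : IsSymmTr (fun _ => (1 : ℝ)) (𝔢.D2J U))
    (Φ Ψ : IBondY x.toKIdx → Matrix (Fin N) (Fin N) ℂ) :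
    ∑ u, trReForm (Ψ u) (((aY x.toKIdx + 𝔢.D2J U).restrictScalars ℝ) Φ u) =
      ∑ u, trReForm (((aY x.toKIdx + 𝔢.D2J U).restrictScalars ℝ) Ψ u) (Φ u) :=
  selfAdjoint_of_isSymmTr _ (isSymmTr_aY_add_D2J x 𝔢 hJ) Φ Ψ

end SymmRows

/-! ## §5  The frame constants of the real trace basis under the `L²`-operator norm: `c_β = n_e = 1` -/

section FrameConstants

open scoped Matrix.Norms.L2Operator
open B9Thm311ReadingCoords (cpart)
open B9CoReadingCoordsTranspose (trReForm TrIdx trBasis trBasis_apply trBasis_repr_apply)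
open B1Eq324BenfattoClassSectEMemberCoRead (trReForm_trBasis_eq_repr)

variable {N : ℕ}

/-- an entry is bounded by the `L²`-operator norm (test against a basis vector). [folklore] -/
private theorem norm_apply_le_norm (A : Matrix (Fin N) (Fin N) ℂ) (a a' : Fin N) : ‖A a a'‖ ≤ ‖A‖ := by
  have h := Matrix.l2_opNorm_mulVec A (EuclideanSpace.single a' (1 : ℂ))
  have h1 : ‖(EuclideanSpace.single a' (1 : ℂ))‖ = 1 := by simp
  rw [h1, mul_one] at h
  refine le_trans ?_ h
  refine le_trans (le_of_eq ?_) (PiLp.norm_apply_le _ a)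
  simp

/-- a real trace coordinate is bounded by the modulus. [folklore] -/
private theorem abs_cpart_le (k : Fin 2) (z : ℂ) : |cpart k z| ≤ ‖z‖ := by
  unfold cpart
  split_ifs
  · exact Complex.abs_re_le_norm z
  · exact Complex.abs_im_le_norm z

/-- ★ **`c_β = 1`**: `|Re tr((E_c)ᴴ v)| ≤ ‖v‖` for seat n06-d's real trace basis and the `L²`-operator norm on `M_N(ℂ)` (the door's `hβn`).
[cite: Balaban1985BackgroundPropagators, p.393 (scalar products), p.389 (matrix-valued functions), bookkeeping] -/
theorem abs_trReForm_trBasis_le (c : TrIdx N) (v : Matrix (Fin N) (Fin N) ℂ) : |trReForm (trBasis N c) v| ≤ 1 * ‖v‖ := by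
  rw [trReForm_trBasis_eq_repr, trBasis_repr_apply, one_mul]
  exact (abs_cpart_le _ _).trans (norm_apply_le_norm v _ _)

/-- ★ **`n_e = 1`**: `‖E_c‖ ≤ 1` for the real trace basis under the `L²`-operator norm (the door's `hen`): `E_c` maps `y` to `u·y_{a′}·δ_a` with `|u| = 1`.
[cite: Balaban1985BackgroundPropagators, p.389 (matrix units), bookkeeping] -/
theorem norm_trBasis_le (c : TrIdx N) : ‖trBasis N c‖ ≤ 1 := by
  set T := Matrix.toEuclideanCLM (n := Fin N) (𝕜 := ℂ) (trBasis N c)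
  rw [← Matrix.l2_opNorm_toEuclideanCLM]
  refine T.opNorm_le_bound zero_le_one fun y => ?_
  have hu : ‖(if c.2.2 = 0 then (1 : ℂ) else Complex.I)‖ = 1 := by split_ifs <;> simp
  have hmv : ∀ w : Fin N → ℂ, trBasis N c *ᵥ w = Pi.single c.1 ((if c.2.2 = 0 then (1 : ℂ) else Complex.I) * w c.2.1) := by
    intro w
    funext i
    simp only [Matrix.mulVec, dotProduct, trBasis_apply]
    by_cases hi : i = c.1
    · subst hi
      rw [Pi.single_eq_same, Finset.sum_eq_single c.2.1]
      · rw [if_pos rfl]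
      · intro j _ hj; rw [if_neg (fun h => hj (Prod.mk.inj h).2), zero_mul]
      · intro h; exact absurd (Finset.mem_univ _) h
    · rw [Pi.single_eq_of_ne hi]
      exact Finset.sum_eq_zero fun j _ => by rw [if_neg (fun h => hi (Prod.mk.inj h).1), zero_mul]
  have hT : T y = EuclideanSpace.single c.1 ((if c.2.2 = 0 then (1 : ℂ) else Complex.I) * y c.2.1) := by
    apply (WithLp.ofLp_injective (p := 2))
    rw [Matrix.ofLp_toEuclideanCLM, hmv]
    rfl
  rw [hT, one_mul]
  calc ‖EuclideanSpace.single c.1 ((if c.2.2 = 0 then (1 : ℂ) else Complex.I) * y c.2.1)‖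
      = ‖(if c.2.2 = 0 then (1 : ℂ) else Complex.I) * y c.2.1‖ := by simp
    _ = ‖y c.2.1‖ := by rw [norm_mul, hu, one_mul]
    _ ≤ ‖y‖ := PiLp.norm_apply_le y c.2.1

end FrameConstants

/-! ## §6  THE PRECISION DOOR AT THE RECORD FIBRE `M_N(ℂ)`: (R1′) in `IsSymmTr` currency, (R3′) and the frame constants DISCHARGED -/

section DoorAtRecord

open scoped Matrix.Norms.L2Operator
open MeasureTheory
open B7Prop2Explicit (unitaryUnits)
open B9Thm311ReadingCoords (trIP IsSymmTr)
open B9CoReadingCoordsTranspose (trReForm trReForm_symm sum_trReForm_eq_trIP TrIdx trBasis)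
open B9PinGeometryKLevelV1 (unitDistY)
open B1Eq324BenfattoLemma (smallFieldSet Coef coefSup cutoffBoltzmann hamiltonian cumulantSum)
open B1Eq324BenfattoClassSectEMemberCoRead (trReForm_trBasis_eq_repr)
open B1Eq324BenfattoClassSectEMemberCoReadProduct (eq324_CsDeltaCY_precision_node00_on_unit)

variable {d : ℕ}

/-- ★★★ **[Balaban1982Higgs1] (3.24) FOR `dμ_{C̃^{(k)}(Λ; U)}` AT NODE 00's GENUINE SEVEN-LETTER RECORD, FIBRE `M_N(ℂ)`, PRECISION CURRENCY, EVERY `η ∈ (0,1]`** —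
p669260 `eq324_CsDeltaCY_precision_node00_on_unit` at the real trace pairing `β := Re tr(vᴴw)` and seat n06-d's orthonormal real trace basis `trBasis N` of
`M_N(ℂ)` (frame constants `c_β = n_e = 1` DISCHARGED under the `L²`-operator norm, §5), at the Sect.-E letters `𝔢 := sectELettersYOfRecordTC x 𝔳 𝔢₀` (def-Y:
`Λ̃ ∕ C(V) ∕ C(V)* ∕ μ ∕ D̄ ∕ μ* ∕ D̄*` genuine over the averaged field `V = 𝔳 U`).  Class scalars `γ₀ > 0`, `B_P, K_J ≥ 0`, rate `δ > 0`, locality radius `r`,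
column mass `m ≥ 0` and the (3.24) letters FIRST ⇒ `∃ b₁ ∀ b₀ > b₁ ∃ C ≥ 0` such that for EVERY `η ∈ (0,1]`, member `x`, covariance letters `𝔏`, averaged
field `𝔳`, residual Sect.-E letters `𝔢₀`, background `U`, injective `ι : σ → Λ̃` (`σ ≠ ∅`), GIVEN: (R1′) `IsSymmTr 1 ((QG₁Q*)⁻¹(U))` and
`IsSymmTr 1 (⟨D̃⁽²⁾·,J⟩(U))` (node N06's «symmetric», Thm 3.11; def-Y `QG1QinvY_isSymmTr` ∕ `sectEYWithDt2_D2J_isSymmTr` at the tables of record); (R2′) the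
(3.132) unit-ball kernel reading of `(QG₁Q*)⁻¹(U)` on ALL index bonds (node N06's ROW for `QG1Qinv` in def-Y's `siteKernelOfOp` shape) and a homogeneous kernel
reading of `a + ⟨D̃⁽²⁾·,J⟩(U)`; (U) `V(b) ∈ U(N)` on every unit bond and the pivot coefficients `K_c(V)`, `K_c(V)*` units (def-Y: automatic at `U = 1` and in
the small-field regime `SmallVY`) — WHICH REPLACE (R3′); (R4′) locality and column mass of `C(V)` along `ι` (seat n08-d's `…ClassSectEMemberERowsAtNode00`);
(R5′) `γ₀·⟨Φ,Φ⟩ ≤ ⟨Φ, C*Δ_kC Φ⟩` in seat n06-j's `trIP 1` currency on `ι(σ)`-supported `Φ` (G-B9-09): the conclusion of the precision door for the Gaussian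
`𝒩(0, 𝕄_ι(C*Δ_kC)⁻¹)` in real trace coordinates — a window `Λ_w ⊂ ℤ^{2(d+1)+1}`, `e′ : σ × TrIdx N ≃ ↥Λ_w` presenting it, the a.e. box identity, the
(3.24) pair.  Proof: §3 (R3′), §4 (R1′), §5 `c_β = n_e = 1`, `sum_trReForm_eq_trIP` for (R5′), into p669260.
[cite: Balaban1985BackgroundPropagators, (3.132) p.422, (3.155)–(3.158) pp.427–428, Thm 3.11 p.416, p.391; Balaban1984PropagatorsII, p.250; Balaban1985UV3, (24)
p.262, (58) p.270, pp.271–272; Balaban1982Higgs1, (3.24) p.616; BenfattoEtAl1978, Lemma (4.5)–(4.7) p.152 (class form; bent window, presentation and coordinates ours)] -/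
theorem eq324_CsDeltaCY_precision_ofRecordTC_trBasis_on_unit (N : ℕ) [NeZero N] {γ₀ BP KJ δ r m : ℝ}
    (hγ₀ : 0 < γ₀) (hBP : 0 ≤ BP) (hKJ : 0 ≤ KJ) (hδ : 0 < δ) (hm : 0 ≤ m) (t D : ℕ) {ϰ : ℝ} (hϰ : 0 < ϰ)
    {p₀ σ' c κ' : ℝ} (hp₀ : 2 / 3 < p₀) (hσ : 0 < σ') (hc : 0 ≤ c) (hκ : 0 < κ') (hκσ : κ' < σ' * (t + 1)) :
    ∃ b₁ : ℝ, ∀ b₀ : ℝ, b₁ < b₀ → ∃ C : ℝ, 0 ≤ C ∧ ∀ η : ℝ, 0 < η → η ≤ 1 →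
      ∀ {ℓ : ℕ} {hd : 1 ≤ d + 1} {hL : Odd (ℓ + 1) ∧ 1 < ℓ + 1} {w₀ w₁ : ℝ} {Mstar : ℕ} (x : MemberY d ℓ hd hL w₀ w₁ Mstar)
        [DecidableEq (IBondY x.toKIdx)]
        (𝔏 : CovLettersY (Matrix (Fin N) (Fin N) ℂ) x) (𝔳 : AvY (Matrix (Fin N) (Fin N) ℂ) x) (𝔢₀ : SectELettersY (Matrix (Fin N) (Fin N) ℂ) x)
        (U : CfgY (Matrix (Fin N) (Fin N) ℂ) x.toKIdx)
      {σ : Type} [Fintype σ] [DecidableEq σ] [Nonempty σ] (ι : σ → IBondY x.toKIdx), Function.Injective ι → (∀ s, lamTY x (ι s)) →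
        IsSymmTr (fun _ => (1 : ℝ)) (𝔏.QG1Qinv U) →
        IsSymmTr (fun _ => (1 : ℝ)) (𝔢₀.D2J U) →
        (∀ u v : IBondY x.toKIdx,
          (⨆ E : BallY (Matrix (Fin N) (Fin N) ℂ), ‖𝔏.QG1Qinv U (deltaY v (E : Matrix (Fin N) (Fin N) ℂ)) u‖) ≤
            BP * Real.exp (-(δ * unitDistY x u v))) →
        (∀ (u v : IBondY x.toKIdx) (E : Matrix (Fin N) (Fin N) ℂ),
          ‖((aY x.toKIdx + 𝔢₀.D2J U).restrictScalars ℝ) (Pi.single v E) u‖ ≤ KJ * ‖E‖ * Real.exp (-(δ * unitDistY x u v))) →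
        (∀ b : UBondY x, ((𝔳 U b : (Matrix (Fin N) (Fin N) ℂ)ˣ) : Matrix (Fin N) (Fin N) ℂ) ∈ unitary (Matrix (Fin N) (Fin N) ℂ)) →
        (∀ c' : CBondY x, IsUnit (KY x 𝔳 U c')) → (∀ c' : CBondY x, IsUnit (KTY x 𝔳 U c')) →
        (∀ (s : σ) (w : Matrix (Fin N) (Fin N) ℂ) (u : IBondY x.toKIdx),
          elimCΛY x (sectELettersYOfRecordTC x 𝔳 𝔢₀) U (Pi.single (ι s) w) u ≠ 0 → unitDistY x u (ι s) ≤ r) →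
        (∀ (s : σ) (c' : TrIdx N), ∑ u, ‖elimCΛY x (sectELettersYOfRecordTC x 𝔳 𝔢₀) U (Pi.single (ι s) (trBasis N c')) u‖ ≤ m) →
        (∀ Φ : IBondY x.toKIdx → Matrix (Fin N) (Fin N) ℂ, (∀ u, u ∉ Set.range ι → Φ u = 0) →
          γ₀ * trIP (fun _ => (1 : ℝ)) Φ Φ ≤ trIP (fun _ => (1 : ℝ)) Φ (CsDeltaCY x 𝔏 (sectELettersYOfRecordTC x 𝔳 𝔢₀) U Φ)) →
      ∃ (Λ : Finset (B1Eq324BenfattoLemma.Site (d + 1 + (d + 1) + 1))) (e' : σ × TrIdx N ≃ ↥Λ),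
        ((gaussianFieldOfKernel fun u w => if h : u ∈ Λ ∧ w ∈ Λ then
            ((Matrix.reindex e' e'
              (Matrix.of fun p q : σ × TrIdx N =>
                  trReForm (trBasis N p.2) (((CsDeltaCY x 𝔏 (sectELettersYOfRecordTC x 𝔳 𝔢₀) U).restrictScalars ℝ)
                    (Pi.single (ι q.1) (trBasis N q.2)) (ι p.1))))⁻¹ :
                Matrix ↥Λ ↥Λ ℝ) ⟨u, h.1⟩ ⟨w, h.2⟩ else 0).map
            (fun (z : B1Eq324BenfattoLemma.Site (d + 1 + (d + 1) + 1) → ℝ) (q : σ × TrIdx N) => z ((e' q : ↥Λ) : B1Eq324BenfattoLemma.Site (d + 1 + (d + 1) + 1))) =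
          gaussianFieldOfKernel fun p q =>
            ((Matrix.of fun p q : σ × TrIdx N =>
                trReForm (trBasis N p.2) (((CsDeltaCY x 𝔏 (sectELettersYOfRecordTC x 𝔳 𝔢₀) U).restrictScalars ℝ)
                  (Pi.single (ι q.1) (trBasis N q.2)) (ι p.1)))⁻¹ :
              Matrix (σ × TrIdx N) (σ × TrIdx N) ℝ) p q) ∧
        (∀ p : ℝ, 0 ≤ p →
          ((fun (z : B1Eq324BenfattoLemma.Site (d + 1 + (d + 1) + 1) → ℝ) (q : σ × TrIdx N) => z ((e' q : ↥Λ) : B1Eq324BenfattoLemma.Site (d + 1 + (d + 1) + 1))) ⁻¹'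
              {ω : σ × TrIdx N → ℝ | ∀ q, |ω q| ≤ p}) =ᵐ[gaussianFieldOfKernel fun u w => if h : u ∈ Λ ∧ w ∈ Λ then
                ((Matrix.reindex e' e'
                  (Matrix.of fun p q : σ × TrIdx N =>
                      trReForm (trBasis N p.2) (((CsDeltaCY x 𝔏 (sectELettersYOfRecordTC x 𝔳 𝔢₀) U).restrictScalars ℝ)
                        (Pi.single (ι q.1) (trBasis N q.2)) (ι p.1))))⁻¹ :
                    Matrix ↥Λ ↥Λ ℝ) ⟨u, h.1⟩ ⟨w, h.2⟩ else 0]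
            smallFieldSet Λ p) ∧
        ∀ (s : ℕ) (I J : Finset (B1Eq324BenfattoLemma.Site (d + 1 + (d + 1) + 1))) (𝔞 : Coef (d + 1 + (d + 1) + 1)),
          I.Nonempty → J ⊆ I → J ⊆ Λ → coefSup s D 𝔞 J ≤ c * η ^ σ' →
          0 < ∫ z, cutoffBoltzmann (hamiltonian s D ϰ 𝔞 J) I (B10.pFun b₀ p₀ η) z ∂(gaussianFieldOfKernel fun u w => if h : u ∈ Λ ∧ w ∈ Λ then
              ((Matrix.reindex e' e'
                (Matrix.of fun p q : σ × TrIdx N =>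
                    trReForm (trBasis N p.2) (((CsDeltaCY x 𝔏 (sectELettersYOfRecordTC x 𝔳 𝔢₀) U).restrictScalars ℝ)
                      (Pi.single (ι q.1) (trBasis N q.2)) (ι p.1))))⁻¹ :
                  Matrix ↥Λ ↥Λ ℝ) ⟨u, h.1⟩ ⟨w, h.2⟩ else 0) ∧
            |Real.log (∫ z, cutoffBoltzmann (hamiltonian s D ϰ 𝔞 J) I (B10.pFun b₀ p₀ η) z ∂(gaussianFieldOfKernel fun u w =>
                if h : u ∈ Λ ∧ w ∈ Λ then
                  ((Matrix.reindex e' e'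
                    (Matrix.of fun p q : σ × TrIdx N =>
                        trReForm (trBasis N p.2) (((CsDeltaCY x 𝔏 (sectELettersYOfRecordTC x 𝔳 𝔢₀) U).restrictScalars ℝ)
                          (Pi.single (ι q.1) (trBasis N q.2)) (ι p.1))))⁻¹ :
                      Matrix ↥Λ ↥Λ ℝ) ⟨u, h.1⟩ ⟨w, h.2⟩ else 0)) -
              cumulantSum (gaussianFieldOfKernel fun u w => if h : u ∈ Λ ∧ w ∈ Λ then
                  ((Matrix.reindex e' e'
                    (Matrix.of fun p q : σ × TrIdx N =>
                        trReForm (trBasis N p.2) (((CsDeltaCY x 𝔏 (sectELettersYOfRecordTC x 𝔳 𝔢₀) U).restrictScalars ℝ)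
                          (Pi.single (ι q.1) (trBasis N q.2)) (ι p.1))))⁻¹ :
                      Matrix ↥Λ ↥Λ ℝ) ⟨u, h.1⟩ ⟨w, h.2⟩ else 0)
                (hamiltonian s D ϰ 𝔞 J) t| ≤ C * η ^ κ' * I.card := by
  obtain ⟨b₁, hb₁⟩ := eq324_CsDeltaCY_precision_node00_on_unit (d := d) (TrIdx N) (cβ := 1) (ne := 1) hγ₀ hBP hKJ hδ hm zero_le_one
    zero_le_one t D hϰ hp₀ hσ hc hκ hκσ (r := r)
  refine ⟨b₁, fun b₀ hb₀ => ?_⟩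
  obtain ⟨C, hC, hE⟩ := hb₁ b₀ hb₀
  refine ⟨C, hC, ?_⟩
  intro η hη hηle ℓ hd hL w₀ w₁ Mstar x _ 𝔏 𝔳 𝔢₀ U σ _ _ _ ι hι hιT hPs hJs hProw hJker h𝔳 hK hKT hloc hmass hco
  exact hE η hη hηle x 𝔏 (sectELettersYOfRecordTC x 𝔳 𝔢₀) U trReForm trReForm_symm (trBasis N)
    (fun v c' => (trReForm_trBasis_eq_repr v c').symm) abs_trReForm_trBasis_le norm_trBasis_le ι hι hιT
    (selfAdjoint_QG1Qinv_of_isSymmTr x 𝔏 hPs) (selfAdjoint_aY_add_D2J_of_isSymmTr x 𝔢₀ hJs) hProw hJker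
    (sum_trReForm_elimCΛY_ofRecordTC x 𝔳 𝔢₀ h𝔳 hK hKT) hloc hmass
    (fun Φ hΦ _ => by rw [LinearMap.coe_restrictScalars, sum_trReForm_eq_trIP, sum_trReForm_eq_trIP]; exact hco Φ hΦ)

/-- ★★★ **THE SAME AT THE v6 INSTANCE OF RECORD** (def-Y `sectEYOfRecordV6 N θ M⋆ 𝔢₀ x = sectELettersYOfRecordTC x (avYOfRecord x) (𝔢₀ x)`, the Sect.-E letters
of NODE 00's `opsYOfRecordV6E`): for `G ≤ U(N)` and a `G`-valued background the averaged field OF RECORD is unitary-valued (`avYOfRecord_mem`), so the unitarity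
binder is DISCHARGED; the pivot-unit binders stay (def-Y: `isUnit_KY_of_smallVY ∕ isUnit_KTY_of_smallVY ∘ smallVY_avYOfRecord` in the small-field regime,
`isUnit_KY_one ∕ isUnit_KTY_one` at `U = 1`). [cite: Balaban1985BackgroundPropagators, (3.157) p.428, (3.40) p.397, (3.132) p.422, Thm 3.11 p.416; Balaban1985UV3, (24) p.262,
pp.271–272; Balaban1982Higgs1, (3.24) p.616; BenfattoEtAl1978, Lemma (4.5)–(4.7) p.152] -/
theorem eq324_CsDeltaCY_precision_sectEYOfRecordV6_trBasis_on_unit (N : ℕ) [NeZero N] (θ : Stage3Params) (Mstar : ℕ) (𝔢₀ : SectEY N θ Mstar)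
    {γ₀ BP KJ δ r m : ℝ}
    (hγ₀ : 0 < γ₀) (hBP : 0 ≤ BP) (hKJ : 0 ≤ KJ) (hδ : 0 < δ) (hm : 0 ≤ m) (t D : ℕ) {ϰ : ℝ} (hϰ : 0 < ϰ)
    {p₀ σ' c κ' : ℝ} (hp₀ : 2 / 3 < p₀) (hσ : 0 < σ') (hc : 0 ≤ c) (hκ : 0 < κ') (hκσ : κ' < σ' * (t + 1)) :
    ∃ b₁ : ℝ, ∀ b₀ : ℝ, b₁ < b₀ → ∃ C : ℝ, 0 ≤ C ∧ ∀ η : ℝ, 0 < η → η ≤ 1 →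
      ∀ (x : MemberY θ.d₆ θ.ℓ₆ θ.hd' θ.hL' θ.b₀ θ.b₁ Mstar) [DecidableEq (IBondY x.toKIdx)]
        (𝔏 : CovLettersY (Matrix (Fin N) (Fin N) ℂ) x) {G : Subgroup (Matrix (Fin N) (Fin N) ℂ)ˣ}, G ≤ unitaryUnits (Matrix (Fin N) (Fin N) ℂ) →
      ∀ (U : CfgY (Matrix (Fin N) (Fin N) ℂ) x.toKIdx), (∀ μ z, U μ z ∈ G) →
      ∀ {σ : Type} [Fintype σ] [DecidableEq σ] [Nonempty σ] (ι : σ → IBondY x.toKIdx), Function.Injective ι → (∀ s, lamTY x (ι s)) →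
        IsSymmTr (fun _ => (1 : ℝ)) (𝔏.QG1Qinv U) →
        IsSymmTr (fun _ => (1 : ℝ)) ((𝔢₀ x).D2J U) →
        (∀ u v : IBondY x.toKIdx,
          (⨆ E : BallY (Matrix (Fin N) (Fin N) ℂ), ‖𝔏.QG1Qinv U (deltaY v (E : Matrix (Fin N) (Fin N) ℂ)) u‖) ≤
            BP * Real.exp (-(δ * unitDistY x u v))) →
        (∀ (u v : IBondY x.toKIdx) (E : Matrix (Fin N) (Fin N) ℂ),
          ‖((aY x.toKIdx + (𝔢₀ x).D2J U).restrictScalars ℝ) (Pi.single v E) u‖ ≤ KJ * ‖E‖ * Real.exp (-(δ * unitDistY x u v))) →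
        (∀ c' : CBondY x, IsUnit (KY x (avYOfRecord x) U c')) → (∀ c' : CBondY x, IsUnit (KTY x (avYOfRecord x) U c')) →
        (∀ (s : σ) (w : Matrix (Fin N) (Fin N) ℂ) (u : IBondY x.toKIdx),
          elimCΛY x (sectEYOfRecordV6 N θ Mstar 𝔢₀ x) U (Pi.single (ι s) w) u ≠ 0 → unitDistY x u (ι s) ≤ r) →
        (∀ (s : σ) (c' : TrIdx N), ∑ u, ‖elimCΛY x (sectEYOfRecordV6 N θ Mstar 𝔢₀ x) U (Pi.single (ι s) (trBasis N c')) u‖ ≤ m) →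
        (∀ Φ : IBondY x.toKIdx → Matrix (Fin N) (Fin N) ℂ, (∀ u, u ∉ Set.range ι → Φ u = 0) →
          γ₀ * trIP (fun _ => (1 : ℝ)) Φ Φ ≤ trIP (fun _ => (1 : ℝ)) Φ (CsDeltaCY x 𝔏 (sectEYOfRecordV6 N θ Mstar 𝔢₀ x) U Φ)) →
      ∃ (Λ : Finset (B1Eq324BenfattoLemma.Site (θ.d₆ + 1 + (θ.d₆ + 1) + 1))) (e' : σ × TrIdx N ≃ ↥Λ),
        ((gaussianFieldOfKernel fun u w => if h : u ∈ Λ ∧ w ∈ Λ then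
            ((Matrix.reindex e' e'
              (Matrix.of fun p q : σ × TrIdx N =>
                  trReForm (trBasis N p.2) (((CsDeltaCY x 𝔏 (sectEYOfRecordV6 N θ Mstar 𝔢₀ x) U).restrictScalars ℝ)
                    (Pi.single (ι q.1) (trBasis N q.2)) (ι p.1))))⁻¹ :
                Matrix ↥Λ ↥Λ ℝ) ⟨u, h.1⟩ ⟨w, h.2⟩ else 0).map
            (fun (z : B1Eq324BenfattoLemma.Site (θ.d₆ + 1 + (θ.d₆ + 1) + 1) → ℝ) (q : σ × TrIdx N) => z ((e' q : ↥Λ) : B1Eq324BenfattoLemma.Site (θ.d₆ + 1 + (θ.d₆ + 1) + 1))) =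
          gaussianFieldOfKernel fun p q =>
            ((Matrix.of fun p q : σ × TrIdx N =>
                trReForm (trBasis N p.2) (((CsDeltaCY x 𝔏 (sectEYOfRecordV6 N θ Mstar 𝔢₀ x) U).restrictScalars ℝ)
                  (Pi.single (ι q.1) (trBasis N q.2)) (ι p.1)))⁻¹ :
              Matrix (σ × TrIdx N) (σ × TrIdx N) ℝ) p q) ∧
        (∀ p : ℝ, 0 ≤ p →
          ((fun (z : B1Eq324BenfattoLemma.Site (θ.d₆ + 1 + (θ.d₆ + 1) + 1) → ℝ) (q : σ × TrIdx N) => z ((e' q : ↥Λ) : B1Eq324BenfattoLemma.Site (θ.d₆ + 1 + (θ.d₆ + 1) + 1))) ⁻¹'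
              {ω : σ × TrIdx N → ℝ | ∀ q, |ω q| ≤ p}) =ᵐ[gaussianFieldOfKernel fun u w => if h : u ∈ Λ ∧ w ∈ Λ then
                ((Matrix.reindex e' e'
                  (Matrix.of fun p q : σ × TrIdx N =>
                      trReForm (trBasis N p.2) (((CsDeltaCY x 𝔏 (sectEYOfRecordV6 N θ Mstar 𝔢₀ x) U).restrictScalars ℝ)
                        (Pi.single (ι q.1) (trBasis N q.2)) (ι p.1))))⁻¹ :
                    Matrix ↥Λ ↥Λ ℝ) ⟨u, h.1⟩ ⟨w, h.2⟩ else 0]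
            smallFieldSet Λ p) ∧
        ∀ (s : ℕ) (I J : Finset (B1Eq324BenfattoLemma.Site (θ.d₆ + 1 + (θ.d₆ + 1) + 1))) (𝔞 : Coef (θ.d₆ + 1 + (θ.d₆ + 1) + 1)),
          I.Nonempty → J ⊆ I → J ⊆ Λ → coefSup s D 𝔞 J ≤ c * η ^ σ' →
          0 < ∫ z, cutoffBoltzmann (hamiltonian s D ϰ 𝔞 J) I (B10.pFun b₀ p₀ η) z ∂(gaussianFieldOfKernel fun u w => if h : u ∈ Λ ∧ w ∈ Λ then
              ((Matrix.reindex e' e'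
                (Matrix.of fun p q : σ × TrIdx N =>
                    trReForm (trBasis N p.2) (((CsDeltaCY x 𝔏 (sectEYOfRecordV6 N θ Mstar 𝔢₀ x) U).restrictScalars ℝ)
                      (Pi.single (ι q.1) (trBasis N q.2)) (ι p.1))))⁻¹ :
                  Matrix ↥Λ ↥Λ ℝ) ⟨u, h.1⟩ ⟨w, h.2⟩ else 0) ∧
            |Real.log (∫ z, cutoffBoltzmann (hamiltonian s D ϰ 𝔞 J) I (B10.pFun b₀ p₀ η) z ∂(gaussianFieldOfKernel fun u w =>
                if h : u ∈ Λ ∧ w ∈ Λ then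
                  ((Matrix.reindex e' e'
                    (Matrix.of fun p q : σ × TrIdx N =>
                        trReForm (trBasis N p.2) (((CsDeltaCY x 𝔏 (sectEYOfRecordV6 N θ Mstar 𝔢₀ x) U).restrictScalars ℝ)
                          (Pi.single (ι q.1) (trBasis N q.2)) (ι p.1))))⁻¹ :
                      Matrix ↥Λ ↥Λ ℝ) ⟨u, h.1⟩ ⟨w, h.2⟩ else 0)) -
              cumulantSum (gaussianFieldOfKernel fun u w => if h : u ∈ Λ ∧ w ∈ Λ then
                  ((Matrix.reindex e' e'
                    (Matrix.of fun p q : σ × TrIdx N =>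
                        trReForm (trBasis N p.2) (((CsDeltaCY x 𝔏 (sectEYOfRecordV6 N θ Mstar 𝔢₀ x) U).restrictScalars ℝ)
                          (Pi.single (ι q.1) (trBasis N q.2)) (ι p.1))))⁻¹ :
                      Matrix ↥Λ ↥Λ ℝ) ⟨u, h.1⟩ ⟨w, h.2⟩ else 0)
                (hamiltonian s D ϰ 𝔞 J) t| ≤ C * η ^ κ' * I.card := by
  obtain ⟨b₁, hb₁⟩ := eq324_CsDeltaCY_precision_ofRecordTC_trBasis_on_unit (d := θ.d₆) N hγ₀ hBP hKJ hδ hm t D hϰ hp₀ hσ hc hκ hκσ (r := r)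
  refine ⟨b₁, fun b₀ hb₀ => ?_⟩
  obtain ⟨C, hC, hE⟩ := hb₁ b₀ hb₀
  refine ⟨C, hC, ?_⟩
  intro η hη hηle x _ 𝔏 G hG U hU σ _ _ _ ι hι hιT hPs hJs hProw hJker hK hKT hloc hmass hco
  exact hE η hη hηle x 𝔏 (avYOfRecord x) (𝔢₀ x) U ι hι hιT hPs hJs hProw hJker
    (fun b => B7Prop2Explicit.mem_unitaryUnits.mp (hG (avYOfRecord_mem x hU b))) hK hKT hloc hmass hco

/-- Non-vacuity of the scalar side of `eq324_CsDeltaCY_precision_ofRecordTC_trBasis_on_unit`: `d + 1 = 4`, `N = 3`, `γ₀ = 1`, `B_P = K_J = 1`, `δ = 1`, `r = 2`,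
`m = 9`, and the socket letters `t = 6`, `D = 4`, `ϰ = 1`, `p₀ = 1`, `σ = 1/2`, `c = 1`, `κ = 13/4`. [cite: Balaban1985UV3, (24) p.262 (letters of the socket; instance ours)] -/
example :=
  eq324_CsDeltaCY_precision_ofRecordTC_trBasis_on_unit (d := 3) 3 (γ₀ := 1) (BP := 1) (KJ := 1) (δ := 1) (r := 2) (m := 9) one_pos zero_le_one
    zero_le_one one_pos (by norm_num) 6 4 (ϰ := 1) one_pos (p₀ := 1) (σ' := 1 / 2) (c := 1) (κ' := 13 / 4) (by norm_num) (by norm_num) zero_le_one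
    (by norm_num) (by norm_num)

/-! ## §7  THE PRECISION DOOR AT THE v6 RECORD IN def-Y's SMALL-FIELD REGIME: (R3′), (R4′), unitarity and the pivot units ALL DISCHARGED -/

/-- ★★★ **[Balaban1982Higgs1] (3.24) FOR `dμ_{C̃^{(k)}(Λ; U)}` AT NODE 00's v6 RECORD IN THE SMALL-FIELD REGIME — MODULO NODE N06's ROWS ONLY.**  For `G ≤ U(N)`
and a background whose averaged field of record is `G`-valued with `‖V(b) − 1‖ ≤ δ_V`, `L^{d+1}·2δ_V(L + (d+1)ℓ) < 1` (def-Y `SmallVY x (avYOfRecord x) G U δ_V`;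
`smallVY_avYOfRecord`), EVERY row of the precision door about the letters `C(V) ∕ C(V)*` is a THEOREM: (R3′) by §3 (reality + flat transposition, pivot units by
`isUnit_KY_of_smallVY ∕ isUnit_KTY_of_smallVY`), (R4′) by seat n08-d's p671113 (`local_elimCΛY_ofRecordTC`: `r := ℓ + 2`; `colMass_elimCΛY_ofRecordTC_of_smallVY`:
`m := 1 + (1 − κ)⁻¹` at `n_e = 1`), the frame constants by §5.  What stays DISPLAYED is node N06's content only: (R1′) `IsSymmTr 1 ((QG₁Q*)⁻¹(U))`,
`IsSymmTr 1 (⟨D̃⁽²⁾·,J⟩(U))`; (R2′) the (3.132) unit-ball kernel reading of `(QG₁Q*)⁻¹(U)` and a kernel reading of `a + ⟨D̃⁽²⁾·,J⟩(U)`; (R5′) `γ₀` in `trIP 1`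
currency (G-B9-09).  Class scalars `γ₀, B_P, K_J, δ`, the small-field size `δ_V` with its smallness inequality, and the (3.24) letters FIRST.
[cite: Balaban1985BackgroundPropagators, (3.157) p.428, (3.35) p.396, (3.40) p.397, (3.132) p.422, Thm 3.11 p.416, p.391; Balaban1985Averaging, (125) p.36; Balaban1985UV3,
(24) p.262, pp.271–272; Balaban1982Higgs1, (3.24) p.616; BenfattoEtAl1978, Lemma (4.5)–(4.7) p.152 (class form; bent window, presentation and coordinates ours)] -/
theorem eq324_CsDeltaCY_precision_sectEYOfRecordV6_trBasis_of_smallVY_on_unit (N : ℕ) [NeZero N] (θ : Stage3Params) (Mstar : ℕ)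
    (𝔢₀ : SectEY N θ Mstar) {γ₀ BP KJ δ δV : ℝ} (hγ₀ : 0 < γ₀) (hBP : 0 ≤ BP) (hKJ : 0 ≤ KJ) (hδ : 0 < δ)
    (hsmall : (((θ.ℓ₆ + 1 : ℕ) : ℝ)) ^ (θ.d₆ + 1) * (2 * δV * (((θ.ℓ₆ + 1 : ℕ) + (θ.d₆ + 1) * θ.ℓ₆ : ℕ) : ℝ)) < 1) (t D : ℕ) {ϰ : ℝ} (hϰ : 0 < ϰ)
    {p₀ σ' c κ' : ℝ} (hp₀ : 2 / 3 < p₀) (hσ : 0 < σ') (hc : 0 ≤ c) (hκ : 0 < κ') (hκσ : κ' < σ' * (t + 1)) :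
    ∃ b₁ : ℝ, ∀ b₀ : ℝ, b₁ < b₀ → ∃ C : ℝ, 0 ≤ C ∧ ∀ η : ℝ, 0 < η → η ≤ 1 →
      ∀ (x : MemberY θ.d₆ θ.ℓ₆ θ.hd' θ.hL' θ.b₀ θ.b₁ Mstar) [DecidableEq (IBondY x.toKIdx)]
        (𝔏 : CovLettersY (Matrix (Fin N) (Fin N) ℂ) x) {G : Subgroup (Matrix (Fin N) (Fin N) ℂ)ˣ}, G ≤ unitaryUnits (Matrix (Fin N) (Fin N) ℂ) →
      ∀ (U : CfgY (Matrix (Fin N) (Fin N) ℂ) x.toKIdx), SmallVY x (avYOfRecord x) G U δV →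
      ∀ {σ : Type} [Fintype σ] [DecidableEq σ] [Nonempty σ] (ι : σ → IBondY x.toKIdx), Function.Injective ι → (∀ s, lamTY x (ι s)) →
        IsSymmTr (fun _ => (1 : ℝ)) (𝔏.QG1Qinv U) →
        IsSymmTr (fun _ => (1 : ℝ)) ((𝔢₀ x).D2J U) →
        (∀ u v : IBondY x.toKIdx,
          (⨆ E : BallY (Matrix (Fin N) (Fin N) ℂ), ‖𝔏.QG1Qinv U (deltaY v (E : Matrix (Fin N) (Fin N) ℂ)) u‖) ≤
            BP * Real.exp (-(δ * unitDistY x u v))) →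
        (∀ (u v : IBondY x.toKIdx) (E : Matrix (Fin N) (Fin N) ℂ),
          ‖((aY x.toKIdx + (𝔢₀ x).D2J U).restrictScalars ℝ) (Pi.single v E) u‖ ≤ KJ * ‖E‖ * Real.exp (-(δ * unitDistY x u v))) →
        (∀ Φ : IBondY x.toKIdx → Matrix (Fin N) (Fin N) ℂ, (∀ u, u ∉ Set.range ι → Φ u = 0) →
          γ₀ * trIP (fun _ => (1 : ℝ)) Φ Φ ≤ trIP (fun _ => (1 : ℝ)) Φ (CsDeltaCY x 𝔏 (sectEYOfRecordV6 N θ Mstar 𝔢₀ x) U Φ)) →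
      ∃ (Λ : Finset (B1Eq324BenfattoLemma.Site (θ.d₆ + 1 + (θ.d₆ + 1) + 1))) (e' : σ × TrIdx N ≃ ↥Λ),
        ((gaussianFieldOfKernel fun u w => if h : u ∈ Λ ∧ w ∈ Λ then
            ((Matrix.reindex e' e'
              (Matrix.of fun p q : σ × TrIdx N =>
                  trReForm (trBasis N p.2) (((CsDeltaCY x 𝔏 (sectEYOfRecordV6 N θ Mstar 𝔢₀ x) U).restrictScalars ℝ)
                    (Pi.single (ι q.1) (trBasis N q.2)) (ι p.1))))⁻¹ :
                Matrix ↥Λ ↥Λ ℝ) ⟨u, h.1⟩ ⟨w, h.2⟩ else 0).map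
            (fun (z : B1Eq324BenfattoLemma.Site (θ.d₆ + 1 + (θ.d₆ + 1) + 1) → ℝ) (q : σ × TrIdx N) => z ((e' q : ↥Λ) : B1Eq324BenfattoLemma.Site (θ.d₆ + 1 + (θ.d₆ + 1) + 1))) =
          gaussianFieldOfKernel fun p q =>
            ((Matrix.of fun p q : σ × TrIdx N =>
                trReForm (trBasis N p.2) (((CsDeltaCY x 𝔏 (sectEYOfRecordV6 N θ Mstar 𝔢₀ x) U).restrictScalars ℝ)
                  (Pi.single (ι q.1) (trBasis N q.2)) (ι p.1)))⁻¹ :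
              Matrix (σ × TrIdx N) (σ × TrIdx N) ℝ) p q) ∧
        (∀ p : ℝ, 0 ≤ p →
          ((fun (z : B1Eq324BenfattoLemma.Site (θ.d₆ + 1 + (θ.d₆ + 1) + 1) → ℝ) (q : σ × TrIdx N) => z ((e' q : ↥Λ) : B1Eq324BenfattoLemma.Site (θ.d₆ + 1 + (θ.d₆ + 1) + 1))) ⁻¹'
              {ω : σ × TrIdx N → ℝ | ∀ q, |ω q| ≤ p}) =ᵐ[gaussianFieldOfKernel fun u w => if h : u ∈ Λ ∧ w ∈ Λ then
                ((Matrix.reindex e' e'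
                  (Matrix.of fun p q : σ × TrIdx N =>
                      trReForm (trBasis N p.2) (((CsDeltaCY x 𝔏 (sectEYOfRecordV6 N θ Mstar 𝔢₀ x) U).restrictScalars ℝ)
                        (Pi.single (ι q.1) (trBasis N q.2)) (ι p.1))))⁻¹ :
                    Matrix ↥Λ ↥Λ ℝ) ⟨u, h.1⟩ ⟨w, h.2⟩ else 0]
            smallFieldSet Λ p) ∧
        ∀ (s : ℕ) (I J : Finset (B1Eq324BenfattoLemma.Site (θ.d₆ + 1 + (θ.d₆ + 1) + 1))) (𝔞 : Coef (θ.d₆ + 1 + (θ.d₆ + 1) + 1)),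
          I.Nonempty → J ⊆ I → J ⊆ Λ → coefSup s D 𝔞 J ≤ c * η ^ σ' →
          0 < ∫ z, cutoffBoltzmann (hamiltonian s D ϰ 𝔞 J) I (B10.pFun b₀ p₀ η) z ∂(gaussianFieldOfKernel fun u w => if h : u ∈ Λ ∧ w ∈ Λ then
              ((Matrix.reindex e' e'
                (Matrix.of fun p q : σ × TrIdx N =>
                    trReForm (trBasis N p.2) (((CsDeltaCY x 𝔏 (sectEYOfRecordV6 N θ Mstar 𝔢₀ x) U).restrictScalars ℝ)
                      (Pi.single (ι q.1) (trBasis N q.2)) (ι p.1))))⁻¹ :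
                  Matrix ↥Λ ↥Λ ℝ) ⟨u, h.1⟩ ⟨w, h.2⟩ else 0) ∧
            |Real.log (∫ z, cutoffBoltzmann (hamiltonian s D ϰ 𝔞 J) I (B10.pFun b₀ p₀ η) z ∂(gaussianFieldOfKernel fun u w =>
                if h : u ∈ Λ ∧ w ∈ Λ then
                  ((Matrix.reindex e' e'
                    (Matrix.of fun p q : σ × TrIdx N =>
                        trReForm (trBasis N p.2) (((CsDeltaCY x 𝔏 (sectEYOfRecordV6 N θ Mstar 𝔢₀ x) U).restrictScalars ℝ)
                          (Pi.single (ι q.1) (trBasis N q.2)) (ι p.1))))⁻¹ :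
                      Matrix ↥Λ ↥Λ ℝ) ⟨u, h.1⟩ ⟨w, h.2⟩ else 0)) -
              cumulantSum (gaussianFieldOfKernel fun u w => if h : u ∈ Λ ∧ w ∈ Λ then
                  ((Matrix.reindex e' e'
                    (Matrix.of fun p q : σ × TrIdx N =>
                        trReForm (trBasis N p.2) (((CsDeltaCY x 𝔏 (sectEYOfRecordV6 N θ Mstar 𝔢₀ x) U).restrictScalars ℝ)
                          (Pi.single (ι q.1) (trBasis N q.2)) (ι p.1))))⁻¹ :
                      Matrix ↥Λ ↥Λ ℝ) ⟨u, h.1⟩ ⟨w, h.2⟩ else 0)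
                (hamiltonian s D ϰ 𝔞 J) t| ≤ C * η ^ κ' * I.card := by
  have hκ0 : 0 < 1 - (((θ.ℓ₆ + 1 : ℕ) : ℝ)) ^ (θ.d₆ + 1) * (2 * δV * (((θ.ℓ₆ + 1 : ℕ) + (θ.d₆ + 1) * θ.ℓ₆ : ℕ) : ℝ)) := sub_pos.2 hsmall
  have hm : (0 : ℝ) ≤ (1 + (1 - (((θ.ℓ₆ + 1 : ℕ) : ℝ)) ^ (θ.d₆ + 1) * (2 * δV * (((θ.ℓ₆ + 1 : ℕ) + (θ.d₆ + 1) * θ.ℓ₆ : ℕ) : ℝ)))⁻¹) * 1 := by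
    rw [mul_one]; exact add_nonneg zero_le_one (inv_nonneg.2 hκ0.le)
  obtain ⟨b₁, hb₁⟩ := eq324_CsDeltaCY_precision_ofRecordTC_trBasis_on_unit (d := θ.d₆) N hγ₀ hBP hKJ hδ hm t D hϰ hp₀ hσ hc hκ hκσ
    (r := (θ.ℓ₆ : ℝ) + 2)
  refine ⟨b₁, fun b₀ hb₀ => ?_⟩
  obtain ⟨C, hC, hE⟩ := hb₁ b₀ hb₀
  refine ⟨C, hC, ?_⟩
  intro η hη hηle x _ 𝔏 G hG U hs σ _ _ _ ι hι hιT hPs hJs hProw hJker hco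
  exact hE η hη hηle x 𝔏 (avYOfRecord x) (𝔢₀ x) U ι hι hιT hPs hJs hProw hJker
    (fun b => B7Prop2Explicit.mem_unitaryUnits.mp (hG (hs.2.1 b))) (isUnit_KY_of_smallVY x _ hs) (isUnit_KTY_of_smallVY x _ hs)
    (B1Eq324BenfattoClassSectEMemberERowsAtNode00.local_elimCΛY_ofRecordTC x (avYOfRecord x) (𝔢₀ x) U ι)
    (B1Eq324BenfattoClassSectEMemberERowsAtNode00.colMass_elimCΛY_ofRecordTC_of_smallVY x (avYOfRecord x) (𝔢₀ x) hs (fun c' => trBasis N c') norm_trBasis_le ι) hco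

end DoorAtRecord

/-! ## §8  (R1′) AT THE TABLES OF RECORD: the precision door at NODE 00's v8 instance of record under print's small curvature (3.35), modulo node N06's
numbered rows and [5]'s reality only -/

section DoorAtRecordV8

open scoped Matrix.Norms.L2Operator
open MeasureTheory
open B7Prop2Explicit (unitaryUnits)
open B6KLevelCensusIndexV1 (KIdx)
open B9Thm311ReadingCoords (trIP IsSymmTr)
open B9CoReadingCoordsTranspose (trReForm TrIdx trBasis)
open B9PinGeometryKLevelV1 (unitDistY)
open B1Eq324BenfattoLemma (smallFieldSet Coef coefSup cutoffBoltzmann hamiltonian cumulantSum)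
open B8Lemma1NonAbelian (pairTop)

variable {N : ℕ}

/-- ★ **`(QG₁Q*)⁻¹(U)` (3.132) OVER def-Y's SYMMETRISED TABLES IS SYMMETRIC** for a `G`-valued configuration, `G ≤ U(N)`, given a symmetric residual letter
`Δ⁽²⁾(U)` — def-Y's `QG1QinvY_isSymmTr` with `hparB ∕ hGp ∕ hR` discharged as in def-Y's `G1Y_isSymmTr_parSymY` (the row `OpsYDelta2Form`'s docstring calls
`covLettersY_v4_QG1Qinv_isSymmTr`; a theorem ABOUT def-Y's letters, filed in this consumer's namespace). [cite: Balaban1985BackgroundPropagators, (3.132) p.422, Thm 3.11 p.416, (3.35) p.396] -/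
theorem QG1QinvY_isSymmTr_parSymY (i : KIdx d ℓ hd hL b₀ b₁) {G : Subgroup (Matrix (Fin N) (Fin N) ℂ)ˣ}
    (hG : G ≤ unitaryUnits (Matrix (Fin N) (Fin N) ℂ)) {U : CfgY (Matrix (Fin N) (Fin N) ℂ) i} (hU : ∀ μ x, U μ x ∈ G)
    (Δ2 : BondOpY (Matrix (Fin N) (Fin N) ℂ) i) (hΔ2 : IsSymmTr (fun _ => (1 : ℝ)) (Δ2 U)) :
    IsSymmTr (fun _ => (1 : ℝ)) (QG1QinvY i (parSymY i) (parBY i) (GpY i (parSymY i)) Δ2 U) :=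
  QG1QinvY_isSymmTr i (parSymY i) (parBY i) (GpY i (parSymY i)) Δ2 U hG hU (fun s s' => parBY_mem i hU s s')
    (B9Ineq349SiteAdjoint.isSymmTr_GpY_parSymY i hG hU) (B9Thm311ProjectionR.RY_parSymY_isSymmTr i hG hU) hΔ2

variable (θ : Stage3Params) (Mstar : ℕ) (𝔯 : ResY N θ Mstar)

/-- ★ **THE v4 RECORD's `(QG₁Q*)⁻¹(U)` IS SYMMETRIC** at every `G`-valued configuration at which the residual letter `(𝔯 x).Δ2` is (the `QG1Qinv` companion
of def-Y's `lettersYOfRecordV4_G₁_isSymmTr ∕ _GG_isSymmTr`). [cite: Balaban1985BackgroundPropagators, (3.132) p.422, Thm 3.11 p.416, (3.35) p.396] -/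
theorem lettersYOfRecordV4_QG1Qinv_isSymmTr {G : Subgroup (Matrix (Fin N) (Fin N) ℂ)ˣ} (hG : G ≤ unitaryUnits (Matrix (Fin N) (Fin N) ℂ))
    (x : MemberY θ.d₆ θ.ℓ₆ θ.hd' θ.hL' θ.b₀ θ.b₁ Mstar) {U : CfgY (Matrix (Fin N) (Fin N) ℂ) x.toKIdx} (hU : ∀ μ z, U μ z ∈ G)
    (hΔ2 : IsSymmTr (fun _ => (1 : ℝ)) ((𝔯 x).Δ2 U)) :
    IsSymmTr (fun _ => (1 : ℝ)) ((lettersYOfRecordV4 N θ Mstar 𝔯 x).QG1Qinv U) :=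
  QG1QinvY_isSymmTr_parSymY x.toKIdx hG hU (𝔯 x).Δ2 hΔ2

/-- ★★★ **[Balaban1982Higgs1] (3.24) FOR `dμ_{C̃^{(k)}(Λ; U)}` AT NODE 00's v8 INSTANCE OF RECORD** (def-Y `opsYOfRecordV8E 𝔠 𝔡₂ 𝔢₀ 𝔴 𝔈`: covariance letters
`lettersYOfRecordV4 … (resYOfC2 𝔠) x`, Sect.-E letters `sectEYOfRecordV6 … (sectEYWithDt2 … (resYOfC2 𝔠) 𝔡₂ 𝔢₀) x` — `Δ⁽²⁾`, `⟨D̃⁽²⁾·,J⟩`, `Λ̃ ∕ C ∕ C* ∕ μ ∕ D̄ ∕ μ* ∕ D̄*`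
genuine, `opsYOfRecordV8E_eq_V4E`) **UNDER PRINT's SMALL CURVATURE (3.35), MODULO NODE N06's NUMBERED ROWS AND [5]'s REALITY ONLY** — the §7 door with def-Y's
small-field predicate REPLACED by print's regime read on the averaged field of record: plaquette smallness `a` of `V = avYOfRecord x U` on the double block
`[c₋, c₋ + pairTop L μ]` of EVERY coarse bond `c = (c₋, μ)` (`B8Lemma1NonAbelian.PlaqSmall (VzY x V) …`), with `L^{d+1}·2(d(2ℓ+1)a)(L + (d+1)ℓ) < 1`.  The pivot units come from
def-Y's `isUnit_KY_KTY_avYOfRecord_of_plaqSmall` (axial gauge on the double block + gauge covariance of `K_c`), the locality radius `ℓ + 2` and the column mass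
`1 + (1 − κ_a)⁻¹` from seat n08-d's `local_elimC_sectEYOfRecordV6` ∕ `colMass_elimC_sectEYOfRecordV6_of_plaqSmall`, (R1′) from def-Y's symmetry theorems as in §8,
(R3′) from §3.  DISPLAYED: `G ≤ U(N)`, `G`-valued `U`, the plaquette smallness, [5]'s reality of `C⁽²⁾(U)`, `D̃⁽²⁾(U)`, and node N06's rows (R2′) ((3.132) reading of
`(QG₁Q*)⁻¹(U)`, a reading of `a + ⟨D̃⁽²⁾·,J⟩(U)`), (R5′) (`γ₀`). [cite: Balaban1985BackgroundPropagators, (3.35) p.396, (3.132) p.422, (3.156)–(3.158) p.428, Thm 3.11 p.416;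
Balaban1985Averaging, (55)–(58) p.27, (109) p.34, (125) p.36; Balaban1985UV3, (24) p.262, pp.271–272; Balaban1982Higgs1, (3.24) p.616; BenfattoEtAl1978, Lemma (4.5)–(4.7)
p.152 (class form; bent window, presentation and coordinates ours)] -/
theorem eq324_CsDeltaCY_precision_opsYOfRecordV8E_trBasis_of_plaqSmall_on_unit (N : ℕ) [NeZero N] (θ : Stage3Params) (Mstar : ℕ)
    (𝔠 : C2Y N θ Mstar) (𝔡₂ : Dt2Y N θ Mstar) (𝔢₀ : SectEY N θ Mstar) {γ₀ BP KJ δ a : ℝ} (hγ₀ : 0 < γ₀) (hBP : 0 ≤ BP) (hKJ : 0 ≤ KJ) (hδ : 0 < δ)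
    (ha : 0 ≤ a) (hsmall : (((θ.ℓ₆ + 1 : ℕ) : ℝ)) ^ (θ.d₆ + 1) *
      (2 * ((((θ.d₆ * (2 * θ.ℓ₆ + 1) : ℕ) : ℝ)) * a) * (((θ.ℓ₆ + 1 : ℕ) + (θ.d₆ + 1) * θ.ℓ₆ : ℕ) : ℝ)) < 1) (t D : ℕ) {ϰ : ℝ} (hϰ : 0 < ϰ)
    {p₀ σ' c κ' : ℝ} (hp₀ : 2 / 3 < p₀) (hσ : 0 < σ') (hc : 0 ≤ c) (hκ : 0 < κ') (hκσ : κ' < σ' * (t + 1)) :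
    ∃ b₁ : ℝ, ∀ b₀ : ℝ, b₁ < b₀ → ∃ C : ℝ, 0 ≤ C ∧ ∀ η : ℝ, 0 < η → η ≤ 1 →
      ∀ (x : MemberY θ.d₆ θ.ℓ₆ θ.hd' θ.hL' θ.b₀ θ.b₁ Mstar) [DecidableEq (IBondY x.toKIdx)]
        {G : Subgroup (Matrix (Fin N) (Fin N) ℂ)ˣ}, G ≤ unitaryUnits (Matrix (Fin N) (Fin N) ℂ) →
      ∀ (U : CfgY (Matrix (Fin N) (Fin N) ℂ) x.toKIdx), (∀ μ z, U μ z ∈ G) →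
        (∀ c' : CBondY x, B8Lemma1NonAbelian.PlaqSmall (VzY x (avYOfRecord x U)) (labK x c'.1.1) (labK x c'.1.1 + pairTop (θ.ℓ₆ + 1) c'.1.2) a) →
        (∀ A A' : FBondY x.toKIdx → Matrix (Fin N) (Fin N) ℂ, (𝔠 x).form U (star A) (star A') = star ((𝔠 x).form U A A')) →
        (∀ B B' : IBondY x.toKIdx → Matrix (Fin N) (Fin N) ℂ, (𝔡₂ x).form U (star B) (star B') = star ((𝔡₂ x).form U B B')) →
      ∀ {σ : Type} [Fintype σ] [DecidableEq σ] [Nonempty σ] (ι : σ → IBondY x.toKIdx), Function.Injective ι → (∀ s, lamTY x (ι s)) →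
        (∀ u v : IBondY x.toKIdx,
          (⨆ E : BallY (Matrix (Fin N) (Fin N) ℂ), ‖(lettersYOfRecordV4 N θ Mstar (resYOfC2 N θ Mstar 𝔠) x).QG1Qinv U (deltaY v (E : Matrix (Fin N) (Fin N) ℂ)) u‖) ≤
            BP * Real.exp (-(δ * unitDistY x u v))) →
        (∀ (u v : IBondY x.toKIdx) (E : Matrix (Fin N) (Fin N) ℂ),
          ‖((aY x.toKIdx + (sectEYWithDt2 N θ Mstar (resYOfC2 N θ Mstar 𝔠) 𝔡₂ 𝔢₀ x).D2J U).restrictScalars ℝ) (Pi.single v E) u‖ ≤ KJ * ‖E‖ * Real.exp (-(δ * unitDistY x u v))) →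
        (∀ Φ : IBondY x.toKIdx → Matrix (Fin N) (Fin N) ℂ, (∀ u, u ∉ Set.range ι → Φ u = 0) →
          γ₀ * trIP (fun _ => (1 : ℝ)) Φ Φ ≤ trIP (fun _ => (1 : ℝ)) Φ (CsDeltaCY x (lettersYOfRecordV4 N θ Mstar (resYOfC2 N θ Mstar 𝔠) x)
            (sectEYOfRecordV6 N θ Mstar (sectEYWithDt2 N θ Mstar (resYOfC2 N θ Mstar 𝔠) 𝔡₂ 𝔢₀) x) U Φ)) →
      ∃ (Λ : Finset (B1Eq324BenfattoLemma.Site (θ.d₆ + 1 + (θ.d₆ + 1) + 1))) (e' : σ × TrIdx N ≃ ↥Λ),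
        ((gaussianFieldOfKernel fun u w => if h : u ∈ Λ ∧ w ∈ Λ then
            ((Matrix.reindex e' e'
              (Matrix.of fun p q : σ × TrIdx N =>
                  trReForm (trBasis N p.2) (((CsDeltaCY x (lettersYOfRecordV4 N θ Mstar (resYOfC2 N θ Mstar 𝔠) x)
            (sectEYOfRecordV6 N θ Mstar (sectEYWithDt2 N θ Mstar (resYOfC2 N θ Mstar 𝔠) 𝔡₂ 𝔢₀) x) U).restrictScalars ℝ)
                    (Pi.single (ι q.1) (trBasis N q.2)) (ι p.1))))⁻¹ :
                Matrix ↥Λ ↥Λ ℝ) ⟨u, h.1⟩ ⟨w, h.2⟩ else 0).map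
            (fun (z : B1Eq324BenfattoLemma.Site (θ.d₆ + 1 + (θ.d₆ + 1) + 1) → ℝ) (q : σ × TrIdx N) => z ((e' q : ↥Λ) : B1Eq324BenfattoLemma.Site (θ.d₆ + 1 + (θ.d₆ + 1) + 1))) =
          gaussianFieldOfKernel fun p q =>
            ((Matrix.of fun p q : σ × TrIdx N =>
                trReForm (trBasis N p.2) (((CsDeltaCY x (lettersYOfRecordV4 N θ Mstar (resYOfC2 N θ Mstar 𝔠) x)
            (sectEYOfRecordV6 N θ Mstar (sectEYWithDt2 N θ Mstar (resYOfC2 N θ Mstar 𝔠) 𝔡₂ 𝔢₀) x) U).restrictScalars ℝ)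
                  (Pi.single (ι q.1) (trBasis N q.2)) (ι p.1)))⁻¹ :
              Matrix (σ × TrIdx N) (σ × TrIdx N) ℝ) p q) ∧
        (∀ p : ℝ, 0 ≤ p →
          ((fun (z : B1Eq324BenfattoLemma.Site (θ.d₆ + 1 + (θ.d₆ + 1) + 1) → ℝ) (q : σ × TrIdx N) => z ((e' q : ↥Λ) : B1Eq324BenfattoLemma.Site (θ.d₆ + 1 + (θ.d₆ + 1) + 1))) ⁻¹'
              {ω : σ × TrIdx N → ℝ | ∀ q, |ω q| ≤ p}) =ᵐ[gaussianFieldOfKernel fun u w => if h : u ∈ Λ ∧ w ∈ Λ then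
                ((Matrix.reindex e' e'
                  (Matrix.of fun p q : σ × TrIdx N =>
                      trReForm (trBasis N p.2) (((CsDeltaCY x (lettersYOfRecordV4 N θ Mstar (resYOfC2 N θ Mstar 𝔠) x)
            (sectEYOfRecordV6 N θ Mstar (sectEYWithDt2 N θ Mstar (resYOfC2 N θ Mstar 𝔠) 𝔡₂ 𝔢₀) x) U).restrictScalars ℝ)
                        (Pi.single (ι q.1) (trBasis N q.2)) (ι p.1))))⁻¹ :
                    Matrix ↥Λ ↥Λ ℝ) ⟨u, h.1⟩ ⟨w, h.2⟩ else 0]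
            smallFieldSet Λ p) ∧
        ∀ (s : ℕ) (I J : Finset (B1Eq324BenfattoLemma.Site (θ.d₆ + 1 + (θ.d₆ + 1) + 1))) (𝔞 : Coef (θ.d₆ + 1 + (θ.d₆ + 1) + 1)),
          I.Nonempty → J ⊆ I → J ⊆ Λ → coefSup s D 𝔞 J ≤ c * η ^ σ' →
          0 < ∫ z, cutoffBoltzmann (hamiltonian s D ϰ 𝔞 J) I (B10.pFun b₀ p₀ η) z ∂(gaussianFieldOfKernel fun u w => if h : u ∈ Λ ∧ w ∈ Λ then
              ((Matrix.reindex e' e'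
                (Matrix.of fun p q : σ × TrIdx N =>
                    trReForm (trBasis N p.2) (((CsDeltaCY x (lettersYOfRecordV4 N θ Mstar (resYOfC2 N θ Mstar 𝔠) x)
            (sectEYOfRecordV6 N θ Mstar (sectEYWithDt2 N θ Mstar (resYOfC2 N θ Mstar 𝔠) 𝔡₂ 𝔢₀) x) U).restrictScalars ℝ)
                      (Pi.single (ι q.1) (trBasis N q.2)) (ι p.1))))⁻¹ :
                  Matrix ↥Λ ↥Λ ℝ) ⟨u, h.1⟩ ⟨w, h.2⟩ else 0) ∧
            |Real.log (∫ z, cutoffBoltzmann (hamiltonian s D ϰ 𝔞 J) I (B10.pFun b₀ p₀ η) z ∂(gaussianFieldOfKernel fun u w =>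
                if h : u ∈ Λ ∧ w ∈ Λ then
                  ((Matrix.reindex e' e'
                    (Matrix.of fun p q : σ × TrIdx N =>
                        trReForm (trBasis N p.2) (((CsDeltaCY x (lettersYOfRecordV4 N θ Mstar (resYOfC2 N θ Mstar 𝔠) x)
            (sectEYOfRecordV6 N θ Mstar (sectEYWithDt2 N θ Mstar (resYOfC2 N θ Mstar 𝔠) 𝔡₂ 𝔢₀) x) U).restrictScalars ℝ)
                          (Pi.single (ι q.1) (trBasis N q.2)) (ι p.1))))⁻¹ :
                      Matrix ↥Λ ↥Λ ℝ) ⟨u, h.1⟩ ⟨w, h.2⟩ else 0)) -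
              cumulantSum (gaussianFieldOfKernel fun u w => if h : u ∈ Λ ∧ w ∈ Λ then
                  ((Matrix.reindex e' e'
                    (Matrix.of fun p q : σ × TrIdx N =>
                        trReForm (trBasis N p.2) (((CsDeltaCY x (lettersYOfRecordV4 N θ Mstar (resYOfC2 N θ Mstar 𝔠) x)
            (sectEYOfRecordV6 N θ Mstar (sectEYWithDt2 N θ Mstar (resYOfC2 N θ Mstar 𝔠) 𝔡₂ 𝔢₀) x) U).restrictScalars ℝ)
                          (Pi.single (ι q.1) (trBasis N q.2)) (ι p.1))))⁻¹ :
                      Matrix ↥Λ ↥Λ ℝ) ⟨u, h.1⟩ ⟨w, h.2⟩ else 0)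
                (hamiltonian s D ϰ 𝔞 J) t| ≤ C * η ^ κ' * I.card := by
  have hκ0 : 0 < 1 - (((θ.ℓ₆ + 1 : ℕ) : ℝ)) ^ (θ.d₆ + 1) *
      (2 * ((((θ.d₆ * (2 * θ.ℓ₆ + 1) : ℕ) : ℝ)) * a) * (((θ.ℓ₆ + 1 : ℕ) + (θ.d₆ + 1) * θ.ℓ₆ : ℕ) : ℝ)) := sub_pos.2 hsmall
  have hm : (0 : ℝ) ≤ (1 + (1 - (((θ.ℓ₆ + 1 : ℕ) : ℝ)) ^ (θ.d₆ + 1) *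
      (2 * ((((θ.d₆ * (2 * θ.ℓ₆ + 1) : ℕ) : ℝ)) * a) * (((θ.ℓ₆ + 1 : ℕ) + (θ.d₆ + 1) * θ.ℓ₆ : ℕ) : ℝ)))⁻¹) * 1 := by
    rw [mul_one]; exact add_nonneg zero_le_one (inv_nonneg.2 hκ0.le)
  obtain ⟨b₁, hb₁⟩ := eq324_CsDeltaCY_precision_sectEYOfRecordV6_trBasis_on_unit N θ Mstar
    (sectEYWithDt2 N θ Mstar (resYOfC2 N θ Mstar 𝔠) 𝔡₂ 𝔢₀) hγ₀ hBP hKJ hδ hm t D hϰ hp₀ hσ hc hκ hκσ (r := (θ.ℓ₆ : ℝ) + 2)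
  refine ⟨b₁, fun b₀ hb₀ => ?_⟩
  obtain ⟨C, hC, hE⟩ := hb₁ b₀ hb₀
  refine ⟨C, hC, ?_⟩
  intro η hη hηle x _ G hG U hU hP hCr hDr σ _ _ _ ι hι hιT hProw hJker hco
  have hUu : ∀ μ z, U μ z ∈ unitaryUnits (Matrix (Fin N) (Fin N) ℂ) := fun μ z => hG (hU μ z)
  exact hE η hη hηle x (lettersYOfRecordV4 N θ Mstar (resYOfC2 N θ Mstar 𝔠) x) hG U hU ι hι hιT
    (lettersYOfRecordV4_QG1Qinv_isSymmTr θ Mstar _ hG x hU (resYOfC2_Δ2_isSymmTr_real θ Mstar 𝔠 x hUu hCr))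
    (sectEYWithDt2_D2J_isSymmTr_ofC2 θ Mstar 𝔠 𝔡₂ 𝔢₀ x hUu hCr hDr) hProw hJker
    (fun c' => (isUnit_KY_KTY_avYOfRecord_of_plaqSmall N θ Mstar x hG hU c' ha (hP c') hsmall).1)
    (fun c' => (isUnit_KY_KTY_avYOfRecord_of_plaqSmall N θ Mstar x hG hU c' ha (hP c') hsmall).2)
    (B1Eq324BenfattoClassSectEMemberERowsAtNode00.local_elimC_sectEYOfRecordV6 N θ Mstar _ x U ι)
    (B1Eq324BenfattoClassSectEMemberERowsAtNode00.colMass_elimC_sectEYOfRecordV6_of_plaqSmall N θ Mstar _ x hG hU ha hP hsmall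
      (fun c' => trBasis N c') norm_trBasis_le ι) hco

end DoorAtRecordV8

end Literature.MathematicalPhysics.QuantumFieldTheory.Balaban1983to89.B1Eq324BenfattoClassSectEMemberRealAdjointAtNode00
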